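import Mathlib
import HarnessLib
import Literature.MathematicalPhysics.QuantumFieldTheory.Balaban1983to89.Setup
import Literature.MathematicalPhysics.QuantumFieldTheory.Balaban1983to89.B10LargeField
import Literature.MathematicalPhysics.QuantumFieldTheory.Balaban1983to89.B10Decomposition7
import Literature.MathematicalPhysics.QuantumFieldTheory.Balaban1983to89.B3Ineq314Cubes

/-!
# `Balaban1983to89.B10Eq38TorusDomains` — [Balaban1985UV3] p. 266, displays **(38)–(40)** and the p. 268 rule ON THE TORUS:
# the small-field domains `Ω₁ ⊃ Ω₂ ⊃ ⋯ ⊃ Ω_k ⊂ T_η` as unions of big blocks of the fine torus `Site P 0` of `Setup`, the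
# separation (39) in print's own form `(Lʲη)⁻¹dist(Ω_jᶜ, Ω_{j+1}) > R(g_j)M₁`, and `ζ_{Λ_j}` WITH A BODY — the torus INSTANCE of
# the cell's abstract carrier `B10LargeField.DomainSeq`

T. Bałaban, *Ultraviolet stability of three-dimensional lattice pure gauge field theories*, Commun. Math. Phys. **102**,
255–275 (1985) [Balaban1985UV3] (cell paper B10; journal page = PDF page + 254; pp. 257, 266, 267, 268 = [PDF 3, 12, 13, 14]
re-read first-hand on the text layer `paper:balaban1985-cmp102-uv-stability-3d` p0003 / p0012 / p0013 / p0014 materialised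
2026-08-23 by `lit read`; «…» = verbatim up to OCR).

HONEST FRAMING (mega-formalization `lit-balaban`, verbatim): statement-level skeleton of published theorems with
citation tags; proofs where landed; nothing here is a claim about the Yang–Mills mass gap.

## The printed text

p. 257 [PDF 3], first step: «to each term of the decomposition we assign a subset Ω₁ ⊂ T₁ defined as a union of big blocks,
i.e. blocks of the size M₁, of the unit lattice T₁, such that their distances to P are > RM₁. We take R = R₁(1 + log g₀⁻¹)^{r₀}
= R₁r(g₀). By this definition p ⊂ Ω₁ᶜ, in fact dist(P, Ω₁) > RM₁».  p. 266 [PDF 12]: «In the first step we have defined the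
small fields regions Ω₁. In the next step we introduce a decomposition of unity (7), but on the domain Ω₁^{(1)} only and with
ε₁ = g₁p(g₁). Each term in the decomposition determines a small fields region Ω₂ in almost the same way as in the first step,
the only difference is that we take blocks with distances to P ∪ Ω₁ᶜ greater than RM₁, where R = R₁r(g₁). Thus we obtain a
sequence of domains  Ω₁ ⊃ Ω₂ ⊃ … ⊃ Ω_k,  Ω_j ⊂ T_η,  (38)  satisfying the conditions  (Lʲη)⁻¹dist(Ω_jᶜ, Ω_{j+1}) > R(g_j)M₁,
R(g_j) = R₁r(g_j),  (39)  Ω_j is a union of big blocks of the size M₁Lʲη. We define the sets Λ_j, 𝔅 as in [5], i.e.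
Λ_j = Ω_j^{(j)}∖Ω_{j+1}^{(j)}, and we denote Z_j = Ω_{j+1}^{(j)c} ⊂ T^{(j)}_{Lʲη}. Gauge field configurations V_j are defined on
Z_j, j = 0, 1, …, k − 1, and functions ζ_{Λ_j} are defined in the same way as ζ_{Ω₁ᶜ} on configurations V_j restricted to Λ_j.»
pp. 267–268 [PDF 13–14]: «We introduce the decomposition of unity (7) for the field V on the domain Λ_k, with ε₁ = g_kp(g_k).
… We define the set Ω^{(k)}_{k+1} as a union of big blocks of the lattice T₁^{(k)}, with distances to P ∪ Ω_k^{(k)c} greater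
than R(g_k)M₁. … The partial resummation over admissible P gives the function ζ_{Λ_k} defined on fields V_k restricted to Λ_k».

## Why this file exists (unit `lit-balaban-r07`, reader/typer and fold owner of B10; gen 52; rows B10.Eq38, B10.Eq39, the
## Λ_j / Z_j / ζ_{Λ_j} clauses of B10.Eq40; member (i) of `B10-CLOSURE.md` §5)

The cell file `…B10LargeField` types (38)–(40) and the p. 268 rule over the SCHEMATIC carrier `DomainSeq` (an abstract point
type `Pt`, abstract block pseudo-distances `bdist j`, collars `collar j`; cell DIVERGENCE D-b10.6) and PROVES rule ⇒ (38),
rule ⇒ (39), the collar mechanism; the definition-display audit of 2026-08-23 (lead's reading rule (a)–(d)) recorded that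
print's INSTANCE — the torus `T_η`, big blocks, the distance of (39), `ζ_{Λ_j}` — was not identified.  This file supplies it:

* §1 big blocks of the fine torus `T_η = Site P 0`: the cubes `cubeIdx s` of [Balaban1983Higgs3] (3.13) (cell module
  `…B3Ineq314Cubes`, REUSED) and «Ω is a union of big blocks of side s» (`IsBlockUnion s Ω`);
* §2 the block distance of two sites = the least torus distance between their big blocks (`blockDist s` = the cell's `cdist`),
  attained, `≤` the site distance, and DETERMINED BY THE BLOCKS;
* §3 **the torus instance** `torusSeq P M₁ R Ω F : B10LargeField.DomainSeq` (`Pt := Site P 0`, `bdist j x y :=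
  (Lʲ)⁻¹·blockDist (M₁Lʲ) x y` = the distance «(Lʲη)⁻¹dist» between the big blocks of `T₁^{(j)}` containing `x`, `y`,
  `collar j := R(g_j)·M₁`), and **(39) AS PRINTED** (`Sep39Printed`: for `x ∉ Ω_j`, `y ∈ Ω_{j+1}`,
  `(Lʲ)⁻¹·|x − y| > R(g_j)M₁`) — EQUIVALENT to the cell's `B10LargeField.Sep39` on block unions (`sep39_iff_printed`);
* §4 **the rule of pp. 257 / 266 / 268 with a body**: `ruleDom M₁ R j Ω_j F` = THE union of the big blocks of `T₁^{(j)}` at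
  distance `> R(g_j)M₁` from `F ∪ Ω_jᶜ` (`F` = the points of the large-field plaquettes `P`), the sequence `omegaSeq` it
  generates from `Ω₀` and the `F_j`, and the record `ruleSeq … : DomainSeq`; PROVED: `Rule268`, `Rule268Max` (by construction),
  hence **(38)** `nested38_ruleSeq`, **(39)** `sep39_ruleSeq` / `sep39Printed_ruleSeq`, the big-block clause
  `isBlockUnion_omegaSeq_succ`, «p ⊂ Ω₁ᶜ» `largeField_subset_Z_ruleSeq`, the collar mechanism `collar_all_scales_ruleSeq`, all
  BY NAME from `…B10LargeField`; the same for ANY choice of sub-unions of the admissible blocks (`rule268_of_subset_ruleDom`,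
  the non-maximal reading of «a union of big blocks … with distances … greater than R(g_k)M₁»); non-vacuity `omegaSeq_univ_of_empty`;
* §5 **`ζ_{Λ_j}` with a body** on print's carrier: for level-`j` plaquettes `Plaq P j` and `V_j : GaugeField P j G`,
  `zetaΛ … T ε₁ V Ω′` := the cell's `B10Decomposition7.zetaDom` (seat p23's body of `ζ_{Ω₁ᶜ}`, «defined in the same way as
  ζ_{Ω₁ᶜ}») with the 0/1 weights of (7) at `dev p = |V_j(∂p) − 1|`, the rule `P ↦ Ω_{j+1}(P)` of §4 read on plaquette sets
  through their corner points in `T_η` (`plaqRule`), and `χ_{Ω′}` over the plaquettes cornered in `Ω′`; PROVED: the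
  resummation identity (8)/(48) `Σ_{admissible Ω_{j+1}} ζ_{Λ_j} χ_{Ω_{j+1}} = 1` ON THE TORUS (`resummation48_torus`), the locality
  «ζ_{Λ_k} defined on fields V_k restricted to Λ_k» (`zetaΛ_local`), `χ_{Ω′}` = the cell's `chiSmall` (`chiΩ_eq_chiSmall`),
  and that every admissible `Ω_{j+1}` is a big-block union inside `Ω_j`, (39)-separated from `Ω_jᶜ` (`admissible_props`), the
  admissible domain of the `P_j`-term being §4's `Ω_{j+1}` (`omegaSeq_succ_eq_plaqRule`, `plaqRule_mem_admissible`).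

DICTIONARY print ↦ Lean: `T_η` (the fine torus at step k; = the original lattice `T_ε`) ↦ `Site P 0` of `Setup`; `T^{(j)}_{Lʲη}`
↦ `Site P j`, read inside `T_η` by `toFine j` (Setup's inclusions `emb`); big block of `T₁^{(j)}` (side `M₁` there, `M₁Lʲη` in
`T_η`) ↦ the cube `cubeIdx (M₁ * L^j)`; «(Lʲη)⁻¹dist» ↦ `(L^j)⁻¹ · Site.tdist` (ℓ¹ torus distance in fine steps, cell DIVERGENCE
F2); `R(g_j)` ↦ `R j` (a real sequence; print's `R₁r(g_j)` = `R₁ * B10.rFun r₀ (g j)`, `collarPrinted`); `P` (large-field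
plaquettes of the passage j → j+1) ↦ a finite set of `Plaq P j`, entering the rule through its corner points `cornerPts`;
`|V_j(∂p) − 1|` ↦ `dist1 (plaqHol V p)`; `ε₁ = g_jp(g_j)` ↦ `g j * B10.pFun b₀ p₀ (g j)`.

v1.1 (same unit, gen 52; APPEND-ONLY — every §1–§5 declaration byte-identical to v1 p362080; answers the B10 second reader's
note L-49, SECOND-READ-B10 pass 42): §6 types the rule's distance AT PRINT'S LETTER — SITE-to-block («distances to P ∪ Ω_k^{(k)c}»
of a BLOCK, p. 268), `siteBlockDist` / `bdistPt` — as the second instance `torusSeqPt` / `ruleDomPt` (THE union of print) / `omegaSeqPt`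
/ `ruleSeqPt` / `plaqRulePt` / `zetaΛPt` with (38), (39), the (8)-resummation and locality by name as in §3–§5; `ruleDom ⊆ ruleDomPt`
(§4's block-to-block condition is the stronger one, so §4's domains are sub-unions of print's); and (39) printed ⇔ block form needing
only the `Ω_{j+1}` to be block unions — hypothesis-free for the print's-letter rule sequence (`sep39_ruleSeqPt_iff_printed`).
v1.2 (same unit; APPEND-ONLY §7, second reader's note L-51): the rule is MONOTONE in the previous domain (`ruleDom_mono`,
`ruleDomPt_mono`), hence §4's sequence lies inside print's scale by scale — `omegaSeq_subset_omegaSeqPt` — and `Z_ruleSeqPt_subset`.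

HONEST SCOPE. (i) Big blocks are the cubes `{x : ⌊x_μ/s⌋ = c_μ}` of the coordinate representatives `x_μ ∈ {0, …, N−1}`
(`N = 2L^{m+K}` sites per direction): a partition of the torus into translates of one cube when `s ∣ N` (print's implicit
situation), with a truncated last cube per direction otherwise — every statement below holds in both cases.  (ii) The rule
at the passage `j → j+1` uses the big blocks of `T₁^{(j)}` (p. 268), i.e. side `M₁Lʲ` in `T_η`; so `Ω_{j+1}` is typed as a union
of side-`M₁Lʲ` cubes (`isBlockUnion_omegaSeq_succ`); print's clause after (39) words the block size of `Ω_j` as `M₁Lʲη` — the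
multi-lattice bookkeeping behind the two wordings (cell DIVERGENCE D-b10.6: traces `Ω^{(j)}`, `B(Λ_{k+1})`) is not modelled
beyond `toFine`.  (iii) «dist» is ℓ¹ in fine lattice steps (DIVERGENCE F2); (39) is typed pointwise («dist(X, Y) > c» ⇔ every
pair of points of X, Y is `> c` apart, X, Y finite); §3–§4's `bdist` is block-to-BLOCK (the cell's abstract `DomainSeq` wording),
§6's `bdistPt` is print's site-to-block letter — `ruleDom ⊆ ruleDomPt`, (38)/(39) for both (v1.1, note L-49).  (iv) `ζ_{Λ_j}`: the plaquette set `T` on which (7) is applied is a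
PARAMETER (print: the plaquettes of the domain `Ω_k^{(k)}`; `plaqsIn` is that reading), the weights are the 0/1 characteristic
functions of (7); locality is proved in the form «depends on `V_j` only through the plaquette variables of `T` not cornered in
`Ω_{j+1}`».  (v) `Ω₀` is a parameter (`Set.univ` = the convention «Λ₀ = Ω₁ᶜ» of (42); p. 257's auxiliary `Ω₀ ⊃ Ω₁` plays no
role).  (vi) NOTHING about (41) / (5) is asserted; d = `P.d` is free (print d = 3).  (vii) The ℤᵈ records of the same
geometry in other blocks — [5] = [Balaban1985RegularSpaces] (1.3)–(1.4) `B8ConstraintBonds.DomainSeq`,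
`B8Eq131CubesAdmissible.cubeFam_domainSeq` — live on `Fin d → ℤ`, not on the torus; no bridge is claimed.

WHAT THIS FILE PROVES (kernel, no `sorry`, no named facts; definitions with bodies — `IsBlockUnion`, `blockDist`, `bdist`,
`collarPrinted`, `torusSeq`, `Sep39Printed`, `ruleDom`, `omegaSeq`, `ruleSeq`, `toFine`, `cornerSet`, `cornerPts`, `plaqRule`,
`plaqsIn`, `dev`, `zetaΛ`, `chiΩ`, `zetaPrinted` (+ v1.1 §6: `siteBlockDist`, `bdistPt`, `torusSeqPt`, `ruleDomPt`, `omegaSeqPt`,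
`ruleSeqPt`, `plaqRulePt`, `zetaΛPt`) — theorems otherwise; axioms standard).  Value = SKELETON rows B10.Eq38 / B10.Eq39
and the set/ζ clauses of B10.Eq40 typed WITH BODIES on print's carrier, the cell's abstract theorems instantiated; NOT a proof
of (41) or (5), NOT summit progress.
-/

noncomputable section

namespace Literature.MathematicalPhysics.QuantumFieldTheory.Balaban1983to89.B10Eq38TorusDomains

open Literature.MathematicalPhysics.QuantumFieldTheory.Balaban1983to89
open Literature.MathematicalPhysics.QuantumFieldTheory.Balaban1983to89.B3Ineq314Cubes (cubeIdx cdist)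
open Literature.MathematicalPhysics.QuantumFieldTheory.Balaban1983to89.B10LargeField (DomainSeq Nested38 Sep39 Rule268
  Rule268Max Z Λ)

variable {P : Params}

/-! ## §1 Big blocks of the fine torus and unions of big blocks -/

section Blocks

variable {n : ℕ}

/-- The torus distance of a site from itself vanishes. (elementary; serves (39)) [cite: Balaban1985UV3, (39) p.266] -/
theorem tdist_self (x : Site P n) : Site.tdist x x = 0 := by
  simp [Site.tdist]

/-- «Ω_j is a union of big blocks of the size M₁Lʲη» (p. 266 after (39); p. 257 «a union of big blocks, i.e. blocks of the size
M₁»): membership in `Ω` depends on a site only through the big block (cube of side `s`, `cubeIdx s`) containing it.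
[cite: Balaban1985UV3, (39) p.266] -/
def IsBlockUnion (s : ℕ) (Ω : Set (Site P n)) : Prop :=
  ∀ ⦃x y : Site P n⦄, cubeIdx s x = cubeIdx s y → (x ∈ Ω ↔ y ∈ Ω)

/-- The whole torus is a union of big blocks. (elementary; serves (39)) [cite: Balaban1985UV3, (39) p.266] -/
theorem isBlockUnion_univ (s : ℕ) : IsBlockUnion s (Set.univ : Set (Site P n)) := fun _ _ _ => by simp

/-- The empty domain is a union of big blocks. (elementary; serves (39)) [cite: Balaban1985UV3, (39) p.266] -/
theorem isBlockUnion_empty (s : ℕ) : IsBlockUnion s (∅ : Set (Site P n)) := fun _ _ _ => by simp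

/-- The complement of a union of big blocks is one (p. 266: `Z_j = Ω_{j+1}^{(j)c}`). [cite: Balaban1985UV3, (39) p.266] -/
theorem IsBlockUnion.compl {s : ℕ} {Ω : Set (Site P n)} (h : IsBlockUnion s Ω) : IsBlockUnion s Ωᶜ :=
  fun _ _ hxy => by rw [Set.mem_compl_iff, Set.mem_compl_iff, h hxy]

/-- Intersections of unions of big blocks are such. (elementary; serves (39)) [cite: Balaban1985UV3, (39) p.266] -/
theorem IsBlockUnion.inter {s : ℕ} {Ω Ω' : Set (Site P n)} (h : IsBlockUnion s Ω) (h' : IsBlockUnion s Ω') :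
    IsBlockUnion s (Ω ∩ Ω') :=
  fun _ _ hxy => by rw [Set.mem_inter_iff, Set.mem_inter_iff, h hxy, h' hxy]

/-- Differences of unions of big blocks are such (p. 266: `Λ_j = Ω_j^{(j)} ∖ Ω_{j+1}^{(j)}`). [cite: Balaban1985UV3, (39) p.266] -/
theorem IsBlockUnion.diff {s : ℕ} {Ω Ω' : Set (Site P n)} (h : IsBlockUnion s Ω) (h' : IsBlockUnion s Ω') :
    IsBlockUnion s (Ω \ Ω') :=
  fun _ _ hxy => by rw [Set.mem_sdiff, Set.mem_sdiff, h hxy, h' hxy]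

/-- Nested cubes: two sites in the same cube of side `s` lie in the same cube of side `s·t` (`⌊⌊v/s⌋/t⌋ = ⌊v/(st)⌋`).
(elementary; serves (39)) [cite: Balaban1985UV3, (39) p.266] -/
theorem cubeIdx_mul_eq_of_eq {s t : ℕ} {x y : Site P n} (h : cubeIdx s x = cubeIdx s y) :
    cubeIdx (s * t) x = cubeIdx (s * t) y := by
  funext μ
  have hμ : (x μ).val / s = (y μ).val / s := congrFun h μ
  show (x μ).val / (s * t) = (y μ).val / (s * t)
  rw [← Nat.div_div_eq_div_mul, ← Nat.div_div_eq_div_mul, hμ]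

/-- A union of big blocks of side `s·t` is a union of blocks of side `s` (the block partitions are nested).
(elementary; serves (39)) [cite: Balaban1985UV3, (39) p.266] -/
theorem IsBlockUnion.of_mul {s t : ℕ} {Ω : Set (Site P n)} (h : IsBlockUnion (s * t) Ω) : IsBlockUnion s Ω :=
  fun _ _ hxy => h (cubeIdx_mul_eq_of_eq hxy)

end Blocks

/-! ## §2 The block distance: the least torus distance between the big blocks of two sites -/

section BlockDist

variable {n : ℕ}

variable (P n) in
/-- The distance, in lattice steps of `Site P n`, between the big block (cube of side `s`) containing `x` and the one containing
`y` — the cell's cube distance `B3Ineq314Cubes.cdist` at the two labels (print, (39): «dist(Ω_jᶜ, Ω_{j+1})» between unions of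
big blocks). [cite: Balaban1985UV3, (39) p.266] -/
def blockDist (s : ℕ) (x y : Site P n) : ℕ := cdist P n s s (cubeIdx s x) (cubeIdx s y)

/-- The block distance is at most the site distance. (elementary; serves (39)) [cite: Balaban1985UV3, (39) p.266] -/
theorem blockDist_le_tdist (s : ℕ) (x y : Site P n) : blockDist P n s x y ≤ Site.tdist x y :=
  B3Ineq314Cubes.cdist_le_tdist s s x y

/-- A block is at distance `0` from itself. (elementary; serves (39)) [cite: Balaban1985UV3, (39) p.266] -/
theorem blockDist_self (s : ℕ) (x : Site P n) : blockDist P n s x x = 0 :=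
  Nat.eq_zero_of_le_zero (le_of_le_of_eq (blockDist_le_tdist s x x) (tdist_self x))

/-- The block distance depends on the sites only through their blocks. (elementary; serves (39)) [cite: Balaban1985UV3, (39) p.266] -/
theorem blockDist_congr {s : ℕ} {x x' y y' : Site P n} (hx : cubeIdx s x = cubeIdx s x') (hy : cubeIdx s y = cubeIdx s y') :
    blockDist P n s x y = blockDist P n s x' y' := by
  unfold blockDist
  rw [hx, hy]

/-- The block distance is ATTAINED: some site of the block of `x` and some site of the block of `y` are exactly that far apart
(a least element of a nonempty set of naturals). (elementary; serves (39)) [cite: Balaban1985UV3, (39) p.266] -/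
theorem blockDist_attained (s : ℕ) (x y : Site P n) :
    ∃ x' y' : Site P n, cubeIdx s x' = cubeIdx s x ∧ cubeIdx s y' = cubeIdx s y ∧
      Site.tdist x' y' = blockDist P n s x y := by
  have hne : {m : ℕ | ∃ x' y' : Site P n, cubeIdx s x' = cubeIdx s x ∧ cubeIdx s y' = cubeIdx s y ∧
      Site.tdist x' y' = m}.Nonempty := ⟨_, x, y, rfl, rfl, rfl⟩
  obtain ⟨x', y', hx', hy', h⟩ := Nat.sInf_mem hne
  exact ⟨x', y', hx', hy', h⟩

/-- Pointwise separation ⇒ block separation: if every site of the block of `x` is more than `c` steps from every site of the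
block of `y` — tested on representatives through block-union sets `X ∋ x`, `Y ∋ y` —, then the blocks are more than `c` apart.
(elementary; serves (39)) [cite: Balaban1985UV3, (39) p.266] -/
theorem lt_blockDist_of_forall {s : ℕ} {X Y : Set (Site P n)} (hX : IsBlockUnion s X) (hY : IsBlockUnion s Y) {c : ℝ}
    (h : ∀ x' ∈ X, ∀ y' ∈ Y, c < (Site.tdist x' y' : ℝ)) {x y : Site P n} (hx : x ∈ X) (hy : y ∈ Y) :
    c < (blockDist P n s x y : ℝ) := by
  obtain ⟨x', y', hx', hy', hd⟩ := blockDist_attained s x y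
  rw [← hd]
  exact h x' ((hX hx').mpr hx) y' ((hY hy').mpr hy)

end BlockDist

/-! ## §3 The torus instance of `B10LargeField.DomainSeq` and (39) as printed -/

section Torus

/-- The block pseudo-distance of scale `j` on the fine torus `T_η = Site P 0`: «(Lʲη)⁻¹dist» (p. 266, (39)) between the big
blocks of the lattice `T₁^{(j)}` (side `M₁` there = `M₁Lʲ` fine steps) containing `x` and `y` — the fine-step block distance
divided by `Lʲ`. [cite: Balaban1985UV3, (39) p.266] -/
def bdist (P : Params) (M₁ : ℕ) (j : ℕ) (x y : Site P 0) : ℝ :=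
  (blockDist P 0 (M₁ * P.L ^ j) x y : ℝ) / (P.L : ℝ) ^ j

/-- `bdist j x x = 0`. (elementary; serves (39)) [cite: Balaban1985UV3, (39) p.266] -/
theorem bdist_self (M₁ j : ℕ) (x : Site P 0) : bdist P M₁ j x x = 0 := by
  simp [bdist, blockDist_self]

/-- `0 ≤ bdist`. (elementary; serves (39)) [cite: Balaban1985UV3, (39) p.266] -/
theorem bdist_nonneg (M₁ j : ℕ) (x y : Site P 0) : 0 ≤ bdist P M₁ j x y := by
  unfold bdist
  positivity

/-- `bdist j` depends on the sites only through their scale-`j` big blocks. (elementary; serves (39)) [cite: Balaban1985UV3, (39) p.266] -/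
theorem bdist_congr {M₁ j : ℕ} {x x' y y' : Site P 0} (hx : cubeIdx (M₁ * P.L ^ j) x = cubeIdx (M₁ * P.L ^ j) x')
    (hy : cubeIdx (M₁ * P.L ^ j) y = cubeIdx (M₁ * P.L ^ j) y') : bdist P M₁ j x y = bdist P M₁ j x' y' := by
  unfold bdist
  rw [blockDist_congr hx hy]

/-- `bdist j x y ≤ (Lʲ)⁻¹|x − y|`. (elementary; serves (39)) [cite: Balaban1985UV3, (39) p.266] -/
theorem bdist_le_tdist_div (M₁ j : ℕ) (x y : Site P 0) :
    bdist P M₁ j x y ≤ (Site.tdist x y : ℝ) / (P.L : ℝ) ^ j := by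
  unfold bdist
  exact div_le_div_of_nonneg_right (by exact_mod_cast blockDist_le_tdist _ x y) (by positivity)

/-- `R(g_j) = R₁r(g_j)` of (39) / p. 257 («We take R = R₁(1 + log g₀⁻¹)^{r₀} = R₁r(g₀)») along a coupling sequence `g`, with
the cell's `B10.rFun`; the collar of (39) is `R(g_j)·M₁`. [cite: Balaban1985UV3, (39) p.266] -/
def collarPrinted (R₁ r₀ : ℝ) (g : ℕ → ℝ) (j : ℕ) : ℝ := R₁ * B10.rFun r₀ (g j)

/-- `collarPrinted` unfolded. [cite: Balaban1985UV3, (39) p.266] -/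
theorem collarPrinted_eq (R₁ r₀ : ℝ) (g : ℕ → ℝ) (j : ℕ) :
    collarPrinted R₁ r₀ g j = R₁ * (1 + Real.log (g j)⁻¹) ^ r₀ := rfl

/-- `R(g_j) ≥ 0` along the printed flow for `R₁ ≥ 0` and `0 < g_j ≤ 1`. (elementary; serves (39)) [cite: Balaban1985UV3, (39) p.266] -/
theorem collarPrinted_nonneg {R₁ r₀ : ℝ} (hR : 0 ≤ R₁) {g : ℕ → ℝ} {j : ℕ} (hg : 0 < g j) (hg1 : g j ≤ 1) :
    0 ≤ collarPrinted R₁ r₀ g j := by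
  unfold collarPrinted B10.rFun
  have hx : 0 ≤ 1 + Real.log (g j)⁻¹ := by
    have := B10.log_inv_nonneg_of_le_one hg hg1
    linarith
  exact mul_nonneg hR (Real.rpow_nonneg hx _)

variable (P) in
/-- **The torus instance of the cell's schematic carrier** `B10LargeField.DomainSeq` (p. 266: «Ω_j ⊂ T_η», (38)): points =
the fine torus `Site P 0`; domains `Ω j` and large-field point sets `F j` as given; `bdist j` = the scale-`j` block
pseudo-distance «(Lʲη)⁻¹dist» between big blocks of `T₁^{(j)}`; `collar j = R(g_j)·M₁` with `R j = R(g_j)`. [cite: Balaban1985UV3, (38)–(39) p.266] -/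
def torusSeq (M₁ : ℕ) (R : ℕ → ℝ) (Ω F : ℕ → Set (Site P 0)) : DomainSeq where
  Pt := Site P 0
  Ω := Ω
  P := F
  bdist := bdist P M₁
  bdist_self := fun j x => bdist_self M₁ j x
  collar := fun j => R j * M₁

/-- The fields of `torusSeq`, unfolded. [cite: Balaban1985UV3, (38)–(39) p.266] -/
theorem torusSeq_Ω (M₁ : ℕ) (R : ℕ → ℝ) (Ω F : ℕ → Set (Site P 0)) (j : ℕ) : (torusSeq P M₁ R Ω F).Ω j = Ω j := rfl

/-- The fields of `torusSeq`, unfolded. [cite: Balaban1985UV3, (38)–(39) p.266] -/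
theorem torusSeq_collar (M₁ : ℕ) (R : ℕ → ℝ) (Ω F : ℕ → Set (Site P 0)) (j : ℕ) :
    (torusSeq P M₁ R Ω F).collar j = R j * M₁ := rfl

/-- The fields of `torusSeq`, unfolded. [cite: Balaban1985UV3, (38)–(39) p.266] -/
theorem torusSeq_bdist (M₁ : ℕ) (R : ℕ → ℝ) (Ω F : ℕ → Set (Site P 0)) (j : ℕ) (x y : Site P 0) :
    (torusSeq P M₁ R Ω F).bdist j x y = bdist P M₁ j x y := rfl

/-- **(39) AS PRINTED**, p. 266: «(Lʲη)⁻¹ dist(Ω_jᶜ, Ω_{j+1}) > R(g_j)M₁» — the distance between the two POINT SETS in units of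
the `Lʲη`-lattice exceeds `R(g_j)M₁`, written pointwise: every site outside `Ω_j` and every site of `Ω_{j+1}` are more than
`R(g_j)M₁Lʲ` fine steps apart. [cite: Balaban1985UV3, (39) p.266] -/
def Sep39Printed (M₁ : ℕ) (R : ℕ → ℝ) (Ω : ℕ → Set (Site P 0)) : Prop :=
  ∀ j (x y : Site P 0), x ∉ Ω j → y ∈ Ω (j + 1) → R j * M₁ < (Site.tdist x y : ℝ) / (P.L : ℝ) ^ j

/-- The cell's block form `B10LargeField.Sep39` on the torus instance IMPLIES (39) as printed (block distance ≤ site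
distance). [cite: Balaban1985UV3, (39) p.266] -/
theorem sep39Printed_of_sep39 {M₁ : ℕ} {R : ℕ → ℝ} {Ω F : ℕ → Set (Site P 0)} (h : Sep39 (torusSeq P M₁ R Ω F)) :
    Sep39Printed M₁ R Ω :=
  fun j x y hx hy => lt_of_lt_of_le (h j x y hx hy) (bdist_le_tdist_div M₁ j x y)

/-- Conversely (39) as printed IMPLIES the block form when `Ω_j` and `Ω_{j+1}` are unions of the big blocks of `T₁^{(j)}` (the
block distance is attained at sites of the same blocks, which lie again outside `Ω_j`, resp. inside `Ω_{j+1}`).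
[cite: Balaban1985UV3, (39) p.266] -/
theorem sep39_of_sep39Printed {M₁ : ℕ} {R : ℕ → ℝ} {Ω F : ℕ → Set (Site P 0)}
    (hΩ : ∀ j, IsBlockUnion (M₁ * P.L ^ j) (Ω j)) (hΩ' : ∀ j, IsBlockUnion (M₁ * P.L ^ j) (Ω (j + 1)))
    (h : Sep39Printed M₁ R Ω) : Sep39 (torusSeq P M₁ R Ω F) := by
  intro j x y hx hy
  show R j * M₁ < (blockDist P 0 (M₁ * P.L ^ j) x y : ℝ) / (P.L : ℝ) ^ j
  have hL : (0 : ℝ) < (P.L : ℝ) ^ j := by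
    have := P.L_pos
    positivity
  rw [lt_div_iff₀ hL]
  refine lt_blockDist_of_forall (hΩ j).compl (hΩ' j) (c := R j * M₁ * (P.L : ℝ) ^ j) ?_ hx hy
  intro x' hx' y' hy'
  exact (lt_div_iff₀ hL).mp (h j x' y' hx' hy')

/-- **(39): printed form ⇔ the cell's block form**, for sequences of big-block unions on the torus.
[cite: Balaban1985UV3, (39) p.266] -/
theorem sep39_iff_printed {M₁ : ℕ} {R : ℕ → ℝ} {Ω F : ℕ → Set (Site P 0)}
    (hΩ : ∀ j, IsBlockUnion (M₁ * P.L ^ j) (Ω j)) (hΩ' : ∀ j, IsBlockUnion (M₁ * P.L ^ j) (Ω (j + 1))) :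
    Sep39 (torusSeq P M₁ R Ω F) ↔ Sep39Printed M₁ R Ω :=
  ⟨sep39Printed_of_sep39, sep39_of_sep39Printed hΩ hΩ'⟩

end Torus

/-! ## §4 The rule of pp. 257 / 266 / 268 with a body, the generated sequence, and (38)–(39) for it -/

section Rule

/-- **The rule**, p. 268: «We define the set Ω^{(k)}_{k+1} as a union of big blocks of the lattice T₁^{(k)}, with distances to
P ∪ Ω_k^{(k)c} greater than R(g_k)M₁» (p. 257: «such that their distances to P are > RM₁»; p. 266: «blocks with distances to
P ∪ Ω₁ᶜ greater than RM₁»), with a BODY on the torus: given the previous domain `Ω_j` and the point set `F` of the large-field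
plaquettes, `Ω_{j+1}` = THE set of sites whose scale-`j` big block is at scaled block distance `> R(g_j)M₁` from every point of
`F` and from every point outside `Ω_j` (the maximal reading `B10LargeField.Rule268Max`; `B10Decomposition7.domRule` /
`omega1` are the cell's abstract-data versions). [cite: Balaban1985UV3, p.268; p.257; (39) p.266] -/
def ruleDom (P : Params) (M₁ : ℕ) (R : ℕ → ℝ) (j : ℕ) (Ωj F : Set (Site P 0)) : Set (Site P 0) :=
  {y | ∀ x : Site P 0, (x ∈ F ∨ x ∉ Ωj) → R j * M₁ < bdist P M₁ j x y}

/-- Membership in `ruleDom`, unfolded. [cite: Balaban1985UV3, p.268] -/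
theorem mem_ruleDom_iff {M₁ : ℕ} {R : ℕ → ℝ} {j : ℕ} {Ωj F : Set (Site P 0)} {y : Site P 0} :
    y ∈ ruleDom P M₁ R j Ωj F ↔ ∀ x : Site P 0, (x ∈ F ∨ x ∉ Ωj) → R j * M₁ < bdist P M₁ j x y := Iff.rfl

/-- «a union of big blocks of the lattice T₁^{(k)}» (p. 268): the domain produced by the rule at the passage `j → j+1` IS a
union of the scale-`j` big blocks (side `M₁Lʲ` in `T_η`). PROVED. [cite: Balaban1985UV3, p.268; (39) p.266] -/
theorem isBlockUnion_ruleDom (M₁ : ℕ) (R : ℕ → ℝ) (j : ℕ) (Ωj F : Set (Site P 0)) :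
    IsBlockUnion (M₁ * P.L ^ j) (ruleDom P M₁ R j Ωj F) := by
  intro y y' hyy'
  simp only [mem_ruleDom_iff]
  constructor
  · intro h x hx
    rw [← bdist_congr rfl hyy']
    exact h x hx
  · intro h x hx
    rw [bdist_congr rfl hyy']
    exact h x hx

/-- The rule shrinks the domain when `R(g_j)M₁ ≥ 0` ((38): a site of `Ω_{j+1}` outside `Ω_j` would be at positive block
distance from itself). [cite: Balaban1985UV3, (38) p.266] -/
theorem ruleDom_subset {M₁ : ℕ} {R : ℕ → ℝ} {j : ℕ} (hR : 0 ≤ R j * M₁) (Ωj F : Set (Site P 0)) :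
    ruleDom P M₁ R j Ωj F ⊆ Ωj := by
  intro y hy
  by_contra hyΩ
  have h := hy y (Or.inr hyΩ)
  rw [bdist_self] at h
  exact absurd h (not_lt.mpr hR)

/-- «By this definition p ⊂ Ω₁ᶜ, in fact dist(P, Ω₁) > RM₁» (p. 257): the large-field points avoid the new domain when
`R(g_j)M₁ ≥ 0`. [cite: Balaban1985UV3, p.257] -/
theorem disjoint_ruleDom {M₁ : ℕ} {R : ℕ → ℝ} {j : ℕ} (hR : 0 ≤ R j * M₁) (Ωj F : Set (Site P 0)) :
    Disjoint F (ruleDom P M₁ R j Ωj F) := by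
  rw [Set.disjoint_left]
  intro x hxF hx
  have h := hx x (Or.inl hxF)
  rw [bdist_self] at h
  exact absurd h (not_lt.mpr hR)

/-- **The sequence of domains generated by the rule** («Thus we obtain a sequence of domains Ω₁ ⊃ Ω₂ ⊃ … ⊃ Ω_k», p. 266): from
`Ω₀` (print's convention (42) «Λ₀ = Ω₁ᶜ» corresponds to `Ω₀ = T_η = Set.univ`) and the large-field point sets `F j` of the
successive passages, `Ω_{j+1} = ruleDom j Ω_j F_j`. [cite: Balaban1985UV3, (38) p.266; p.268] -/
def omegaSeq (P : Params) (M₁ : ℕ) (R : ℕ → ℝ) (Ω₀ : Set (Site P 0)) (F : ℕ → Set (Site P 0)) : ℕ → Set (Site P 0)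
  | 0 => Ω₀
  | j + 1 => ruleDom P M₁ R j (omegaSeq P M₁ R Ω₀ F j) (F j)

/-- `omegaSeq` at `0`. [cite: Balaban1985UV3, (38) p.266] -/
@[simp] theorem omegaSeq_zero (M₁ : ℕ) (R : ℕ → ℝ) (Ω₀ : Set (Site P 0)) (F : ℕ → Set (Site P 0)) :
    omegaSeq P M₁ R Ω₀ F 0 = Ω₀ := rfl

/-- `omegaSeq` at `j + 1` is the rule applied to `omegaSeq j`. [cite: Balaban1985UV3, p.268] -/
theorem omegaSeq_succ (M₁ : ℕ) (R : ℕ → ℝ) (Ω₀ : Set (Site P 0)) (F : ℕ → Set (Site P 0)) (j : ℕ) :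
    omegaSeq P M₁ R Ω₀ F (j + 1) = ruleDom P M₁ R j (omegaSeq P M₁ R Ω₀ F j) (F j) := rfl

variable (P) in
/-- The cell's record for the generated sequence: the torus `DomainSeq` with `Ω = omegaSeq`. [cite: Balaban1985UV3, (38)–(39) p.266; p.268] -/
def ruleSeq (M₁ : ℕ) (R : ℕ → ℝ) (Ω₀ : Set (Site P 0)) (F : ℕ → Set (Site P 0)) : DomainSeq :=
  torusSeq P M₁ R (omegaSeq P M₁ R Ω₀ F) F

/-- **The rule holds for the generated sequence** (the cell's `B10LargeField.Rule268`: every site of `Ω_{j+1}` is at scaled block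
distance `> R(g_j)M₁` from `P_j` and from `Ω_jᶜ`) — by construction. [cite: Balaban1985UV3, p.268] -/
theorem rule268_ruleSeq (M₁ : ℕ) (R : ℕ → ℝ) (Ω₀ : Set (Site P 0)) (F : ℕ → Set (Site P 0)) :
    Rule268 (ruleSeq P M₁ R Ω₀ F) :=
  fun _ _ hy x hx => hy x hx

/-- **The maximal reading holds too** (`B10LargeField.Rule268Max`: every site whose block is that far from `P_j ∪ Ω_jᶜ` belongs to
`Ω_{j+1}` — «THE union of the big blocks with distances … greater than R(g_k)M₁»). [cite: Balaban1985UV3, p.268] -/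
theorem rule268Max_ruleSeq (M₁ : ℕ) (R : ℕ → ℝ) (Ω₀ : Set (Site P 0)) (F : ℕ → Set (Site P 0)) :
    Rule268Max (ruleSeq P M₁ R Ω₀ F) :=
  fun _ _ hy => hy

/-- **(38) for the generated sequence on the torus**: «Ω₁ ⊃ Ω₂ ⊃ … ⊃ Ω_k, Ω_j ⊂ T_η» — BY NAME from the cell's
`B10LargeField.nested38_of_rule268` (needs `R(g_j)M₁ ≥ 0`). [cite: Balaban1985UV3, (38) p.266] -/
theorem nested38_ruleSeq {M₁ : ℕ} {R : ℕ → ℝ} (hR : ∀ j, 0 ≤ R j * M₁) (Ω₀ : Set (Site P 0)) (F : ℕ → Set (Site P 0)) :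
    Nested38 (ruleSeq P M₁ R Ω₀ F) :=
  B10LargeField.nested38_of_rule268 _ hR (rule268_ruleSeq M₁ R Ω₀ F)

/-- (38) unfolded: `Ω_{j+1} ⊆ Ω_j` as subsets of `T_η`. [cite: Balaban1985UV3, (38) p.266] -/
theorem omegaSeq_succ_subset {M₁ : ℕ} {R : ℕ → ℝ} (hR : ∀ j, 0 ≤ R j * M₁) (Ω₀ : Set (Site P 0))
    (F : ℕ → Set (Site P 0)) (j : ℕ) : omegaSeq P M₁ R Ω₀ F (j + 1) ⊆ omegaSeq P M₁ R Ω₀ F j :=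
  nested38_ruleSeq hR Ω₀ F j

/-- (38) iterated: `Ω_j ⊆ Ω_i` for `i ≤ j`. [cite: Balaban1985UV3, (38) p.266] -/
theorem omegaSeq_antitone {M₁ : ℕ} {R : ℕ → ℝ} (hR : ∀ j, 0 ≤ R j * M₁) (Ω₀ : Set (Site P 0))
    (F : ℕ → Set (Site P 0)) : Antitone (omegaSeq P M₁ R Ω₀ F) :=
  antitone_nat_of_succ_le fun j => omegaSeq_succ_subset hR Ω₀ F j

/-- **(39) for the generated sequence, the cell's block form** — BY NAME from `B10LargeField.sep39_of_rule268`.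
[cite: Balaban1985UV3, (39) p.266] -/
theorem sep39_ruleSeq (M₁ : ℕ) (R : ℕ → ℝ) (Ω₀ : Set (Site P 0)) (F : ℕ → Set (Site P 0)) :
    Sep39 (ruleSeq P M₁ R Ω₀ F) :=
  B10LargeField.sep39_of_rule268 _ (rule268_ruleSeq M₁ R Ω₀ F)

/-- **(39) for the generated sequence, AS PRINTED**: «(Lʲη)⁻¹ dist(Ω_jᶜ, Ω_{j+1}) > R(g_j)M₁». PROVED. [cite: Balaban1985UV3, (39) p.266] -/
theorem sep39Printed_ruleSeq (M₁ : ℕ) (R : ℕ → ℝ) (Ω₀ : Set (Site P 0)) (F : ℕ → Set (Site P 0)) :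
    Sep39Printed M₁ R (omegaSeq P M₁ R Ω₀ F) :=
  sep39Printed_of_sep39 (sep39_ruleSeq M₁ R Ω₀ F)

/-- **«Ω_j is a union of big blocks»** for the generated sequence: `Ω_{j+1}` is a union of the big blocks of `T₁^{(j)}` (side
`M₁Lʲ` fine steps). PROVED. [cite: Balaban1985UV3, (39) p.266; p.268] -/
theorem isBlockUnion_omegaSeq_succ (M₁ : ℕ) (R : ℕ → ℝ) (Ω₀ : Set (Site P 0)) (F : ℕ → Set (Site P 0)) (j : ℕ) :
    IsBlockUnion (M₁ * P.L ^ j) (omegaSeq P M₁ R Ω₀ F (j + 1)) :=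
  isBlockUnion_ruleDom M₁ R j _ _

/-- … hence also a union of the big blocks of every FINER scale `i ≤ j` (side `M₁Lⁱ`; nested block partitions).
[cite: Balaban1985UV3, (39) p.266] -/
theorem isBlockUnion_omegaSeq_succ_of_le (M₁ : ℕ) (R : ℕ → ℝ) (Ω₀ : Set (Site P 0)) (F : ℕ → Set (Site P 0))
    {i j : ℕ} (hij : i ≤ j) : IsBlockUnion (M₁ * P.L ^ i) (omegaSeq P M₁ R Ω₀ F (j + 1)) := by
  have h := isBlockUnion_omegaSeq_succ M₁ R Ω₀ F j
  have hpow : M₁ * P.L ^ j = M₁ * P.L ^ i * P.L ^ (j - i) := by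
    rw [mul_assoc, ← pow_add, Nat.add_sub_cancel' hij]
  rw [hpow] at h
  exact h.of_mul

/-- `Λ_j = Ω_j ∖ Ω_{j+1}` and `Z_j = Ω_{j+1}ᶜ` of the generated sequence are unions of the scale-`j` big blocks as soon as `Ω_j`
is (p. 266: «Z_j = Ω_{j+1}^{(j)c} ⊂ T^{(j)}_{Lʲη}»). [cite: Balaban1985UV3, (40) p.266] -/
theorem isBlockUnion_Λ_Z {M₁ : ℕ} {R : ℕ → ℝ} {Ω₀ : Set (Site P 0)} {F : ℕ → Set (Site P 0)} {j : ℕ}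
    (hj : IsBlockUnion (M₁ * P.L ^ j) (omegaSeq P M₁ R Ω₀ F j)) :
    IsBlockUnion (M₁ * P.L ^ j) (Λ (ruleSeq P M₁ R Ω₀ F) j) ∧ IsBlockUnion (M₁ * P.L ^ j) (Z (ruleSeq P M₁ R Ω₀ F) j) :=
  ⟨hj.diff (isBlockUnion_omegaSeq_succ M₁ R Ω₀ F j), (isBlockUnion_omegaSeq_succ M₁ R Ω₀ F j).compl⟩

/-- «By this definition p ⊂ Ω₁ᶜ» / «a plaquette p′ ⊂ Λ_j» on the torus: the large-field points of the passage `j → j+1` lie in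
`Z_j = Ω_{j+1}ᶜ` — BY NAME from `B10LargeField.largeField_subset_Z`. [cite: Balaban1985UV3, p.257; p.273] -/
theorem largeField_subset_Z_ruleSeq {M₁ : ℕ} {R : ℕ → ℝ} (hR : ∀ j, 0 ≤ R j * M₁) (Ω₀ : Set (Site P 0))
    (F : ℕ → Set (Site P 0)) (j : ℕ) : F j ⊆ Z (ruleSeq P M₁ R Ω₀ F) j :=
  B10LargeField.largeField_subset_Z _ hR (rule268_ruleSeq M₁ R Ω₀ F) j

/-- **The collar mechanism on the torus** (cell GAPS G-adv2-7; `B10LargeField.collar_all_scales` BY NAME): a large-field point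
`p ∈ P_i` keeps, at every later scale `j ≥ i`, its whole scaled block collar of radius `R(g_j)M₁` inside `Z_j`.
[cite: Balaban1985UV3, (39) p.266; pp.267–268] -/
theorem collar_all_scales_ruleSeq {M₁ : ℕ} {R : ℕ → ℝ} (hR : ∀ j, 0 ≤ R j * M₁) (Ω₀ : Set (Site P 0))
    (F : ℕ → Set (Site P 0)) {i j : ℕ} (hij : i ≤ j) {p : Site P 0} (hp : p ∈ F i) (y : Site P 0)
    (hy : bdist P M₁ j p y ≤ R j * M₁) : y ∈ Z (ruleSeq P M₁ R Ω₀ F) j :=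
  B10LargeField.collar_all_scales _ hR (rule268_ruleSeq M₁ R Ω₀ F) hij hp y hy

/-- With the printed collar `R(g_j) = R₁r(g_j)` along a flow `0 < g_j ≤ 1` and `R₁ ≥ 0` the hypothesis `R(g_j)M₁ ≥ 0` of
(38) holds at every scale. (elementary; serves (38)) [cite: Balaban1985UV3, (39) p.266] -/
theorem collarPrinted_mul_nonneg {R₁ r₀ : ℝ} (hR : 0 ≤ R₁) {g : ℕ → ℝ} (hg : ∀ j, 0 < g j ∧ g j ≤ 1) (M₁ : ℕ) :
    ∀ j, 0 ≤ collarPrinted R₁ r₀ g j * M₁ :=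
  fun j => mul_nonneg (collarPrinted_nonneg hR (hg j).1 (hg j).2) (Nat.cast_nonneg M₁)

/-- (38) for the generated sequence with the PRINTED collar `R₁r(g_j)M₁` (no sign hypothesis left beyond `R₁ ≥ 0`,
`0 < g_j ≤ 1`). [cite: Balaban1985UV3, (38)–(39) p.266] -/
theorem nested38_ruleSeq_printed {R₁ r₀ : ℝ} (hR : 0 ≤ R₁) {g : ℕ → ℝ} (hg : ∀ j, 0 < g j ∧ g j ≤ 1) (M₁ : ℕ)
    (Ω₀ : Set (Site P 0)) (F : ℕ → Set (Site P 0)) : Nested38 (ruleSeq P M₁ (collarPrinted R₁ r₀ g) Ω₀ F) :=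
  nested38_ruleSeq (collarPrinted_mul_nonneg hR hg M₁) Ω₀ F

/-- With NO large fields at any passage (`P_j = ∅`) and `Ω₀ = T_η` the rule never removes a block: `Ω_j = T_η` for every `j`
(the everywhere-small-field term; cf. [5] p. 77 «we admit the case where some domains Ω_j are equal to T_η»). Non-vacuity of
the torus rule. [cite: Balaban1985UV3, (38) p.266; p.268] -/
theorem omegaSeq_univ_of_empty (M₁ : ℕ) (R : ℕ → ℝ) (j : ℕ) :
    omegaSeq P M₁ R Set.univ (fun _ => ∅) j = Set.univ := by
  induction j with
  | zero => rfl
  | succ j ih =>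
    rw [omegaSeq_succ, ih]
    exact Set.eq_univ_of_forall fun _ x hx => by simp at hx

/-- **The non-maximal reading.**  Print says «a union of big blocks … with distances … greater than R(g_k)M₁»; the cell's
`B10LargeField.Rule268` records only what this IMPOSES on the chosen blocks.  On the torus: ANY sequence with
`Ω_{j+1} ⊆ ruleDom j Ω_j P_j` (a sub-union of the admissible big blocks) satisfies `Rule268`, hence (38) and (39) — BY NAME.
[cite: Balaban1985UV3, p.268; (38)–(39) p.266] -/
theorem rule268_of_subset_ruleDom {M₁ : ℕ} {R : ℕ → ℝ} {Ω F : ℕ → Set (Site P 0)}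
    (h : ∀ j, Ω (j + 1) ⊆ ruleDom P M₁ R j (Ω j) (F j)) : Rule268 (torusSeq P M₁ R Ω F) :=
  fun j _ hy x hx => h j hy x hx

/-- (38) for every sequence of sub-unions of the admissible blocks. [cite: Balaban1985UV3, (38) p.266] -/
theorem nested38_of_subset_ruleDom {M₁ : ℕ} {R : ℕ → ℝ} (hR : ∀ j, 0 ≤ R j * M₁) {Ω F : ℕ → Set (Site P 0)}
    (h : ∀ j, Ω (j + 1) ⊆ ruleDom P M₁ R j (Ω j) (F j)) : Nested38 (torusSeq P M₁ R Ω F) :=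
  B10LargeField.nested38_of_rule268 _ hR (rule268_of_subset_ruleDom h)

/-- (39), block form and printed form, for every sequence of sub-unions of the admissible blocks. [cite: Balaban1985UV3, (39) p.266] -/
theorem sep39_of_subset_ruleDom {M₁ : ℕ} {R : ℕ → ℝ} {Ω F : ℕ → Set (Site P 0)}
    (h : ∀ j, Ω (j + 1) ⊆ ruleDom P M₁ R j (Ω j) (F j)) :
    Sep39 (torusSeq P M₁ R Ω F) ∧ Sep39Printed M₁ R Ω :=
  have h39 := B10LargeField.sep39_of_rule268 _ (rule268_of_subset_ruleDom h)
  ⟨h39, sep39Printed_of_sep39 h39⟩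

end Rule

/-! ## §5 `ζ_{Λ_j}` with a body: the resummation (8) at the passage `j → j+1` on the torus, and its locality -/

section Zeta

/-- The inclusion `T^{(j)}_{Lʲη} ⊂ T_η` of the scale-`j` lattice into the fine torus: Setup's one-step inclusions `emb`
(`T^{(i+1)} ⊂ T^{(i)}`) composed down to level `0` (p. 266: «Ω_j^{(j)}», the trace of `Ω_j ⊂ T_η` on `T^{(j)}_{Lʲη}`, is read
through this map). [cite: Balaban1985UV3, (38) p.266] -/
def toFine : (j : ℕ) → Site P j → Site P 0
  | 0 => fun x => x
  | j + 1 => fun y => toFine j (emb y)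

/-- `toFine 0 = id`. [cite: Balaban1985UV3, (38) p.266] -/
@[simp] theorem toFine_zero (x : Site P 0) : toFine 0 x = x := rfl

/-- `toFine (j+1) = toFine j ∘ emb`. [cite: Balaban1985UV3, (38) p.266] -/
theorem toFine_succ (j : ℕ) (y : Site P (j + 1)) : toFine (j + 1) y = toFine j (emb y) := rfl

/-- The four corners `x, x + e_μ, x + e_ν, x + e_μ + e_ν` of a plaquette `p` of `T^{(j)}` as points of the fine torus `T_η`
(p. 258: «plaquettes with at least one corner belonging to Ω₁»; the corners are those of `GaugeField.plaqHol`).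
[cite: Balaban1985UV3, (8) p.258] -/
def cornerSet (j : ℕ) (p : Plaq P j) : Set (Site P 0) :=
  {toFine j p.src, toFine j (p.src.shift p.μ), toFine j (p.src.shift p.ν), toFine j ((p.src.shift p.μ).shift p.ν)}

/-- The point set `P ⊂ T_η` of a finite set of large-field plaquettes of `T^{(j)}`: the union of their corner sets («their
distances to P», p. 257; «distances to P ∪ Ω_k^{(k)c}», p. 268 — distances to plaquettes are distances to their lattice
points). [cite: Balaban1985UV3, p.257; p.268] -/
def cornerPts (j : ℕ) (S : Finset (Plaq P j)) : Set (Site P 0) := ⋃ p ∈ S, cornerSet j p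

/-- A corner of a plaquette of `S` is a point of `P`. [cite: Balaban1985UV3, p.257] -/
theorem cornerSet_subset_cornerPts {j : ℕ} {S : Finset (Plaq P j)} {p : Plaq P j} (hp : p ∈ S) :
    cornerSet j p ⊆ cornerPts j S := by
  intro x hx
  exact Set.mem_biUnion (Finset.mem_coe.mpr hp) hx

variable (P) in
/-- **The rule `P ↦ Ω_{j+1}(P)` read on plaquette sets** (p. 268 «with distances to P ∪ Ω_k^{(k)c} greater than R(g_k)M₁»):
§4's `ruleDom` at the corner point set of `P`. [cite: Balaban1985UV3, p.268; p.257] -/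
def plaqRule (M₁ : ℕ) (R : ℕ → ℝ) (j : ℕ) (Ωj : Set (Site P 0)) (S : Finset (Plaq P j)) : Set (Site P 0) :=
  ruleDom P M₁ R j Ωj (cornerPts j S)

/-- `plaqRule` is `ruleDom` at the corner points (definitional). [cite: Balaban1985UV3, p.268] -/
theorem ruleDom_eq_plaqRule (M₁ : ℕ) (R : ℕ → ℝ) (j : ℕ) (Ωj : Set (Site P 0)) (S : Finset (Plaq P j)) :
    ruleDom P M₁ R j Ωj (cornerPts j S) = plaqRule P M₁ R j Ωj S := rfl

/-- Every `Ω_{j+1}(P)` is a union of the scale-`j` big blocks. [cite: Balaban1985UV3, p.268; (39) p.266] -/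
theorem isBlockUnion_plaqRule (M₁ : ℕ) (R : ℕ → ℝ) (j : ℕ) (Ωj : Set (Site P 0)) (S : Finset (Plaq P j)) :
    IsBlockUnion (M₁ * P.L ^ j) (plaqRule P M₁ R j Ωj S) :=
  isBlockUnion_ruleDom M₁ R j Ωj _

/-- Every `Ω_{j+1}(P)` lies in `Ω_j` ((38)) when `R(g_j)M₁ ≥ 0`. [cite: Balaban1985UV3, (38) p.266] -/
theorem plaqRule_subset {M₁ : ℕ} {R : ℕ → ℝ} {j : ℕ} (hR : 0 ≤ R j * M₁) (Ωj : Set (Site P 0)) (S : Finset (Plaq P j)) :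
    plaqRule P M₁ R j Ωj S ⊆ Ωj :=
  ruleDom_subset hR Ωj _

/-- Every `Ω_{j+1}(P)` is separated from `Ω_jᶜ` as in (39), printed form: for `x ∉ Ω_j`, `y ∈ Ω_{j+1}(P)`,
`(Lʲ)⁻¹|x − y| > R(g_j)M₁`. [cite: Balaban1985UV3, (39) p.266] -/
theorem sep_plaqRule {M₁ : ℕ} {R : ℕ → ℝ} {j : ℕ} {Ωj : Set (Site P 0)} {S : Finset (Plaq P j)} {x y : Site P 0}
    (hx : x ∉ Ωj) (hy : y ∈ plaqRule P M₁ R j Ωj S) : R j * M₁ < (Site.tdist x y : ℝ) / (P.L : ℝ) ^ j :=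
  lt_of_lt_of_le (hy x (Or.inr hx)) (bdist_le_tdist_div M₁ j x y)

/-- «in fact dist(P, Ω₁) > RM₁» (p. 257) at the passage `j → j+1`: every corner of a plaquette of `P` is more than
`R(g_j)M₁Lʲ` fine steps from `Ω_{j+1}(P)`. [cite: Balaban1985UV3, p.257; p.268] -/
theorem sep_plaqRule_of_mem {M₁ : ℕ} {R : ℕ → ℝ} {j : ℕ} {Ωj : Set (Site P 0)} {S : Finset (Plaq P j)} {x y : Site P 0}
    (hx : x ∈ cornerPts j S) (hy : y ∈ plaqRule P M₁ R j Ωj S) : R j * M₁ < (Site.tdist x y : ℝ) / (P.L : ℝ) ^ j :=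
  lt_of_lt_of_le (hy x (Or.inl hx)) (bdist_le_tdist_div M₁ j x y)

/-- The deviation `|V_j(∂p) − 1|` of a plaquette variable from the identity ((7) p. 257, (40) p. 266), in the `GaugeGroup`
interface of `Setup` (`dist1 = |· − 1|`). [cite: Balaban1985UV3, (7) p.257; (40) p.266] -/
def dev {G : Type*} [GaugeGroup G] {j : ℕ} (V : GaugeField P j G) (p : Plaq P j) : ℝ :=
  dist1 (GaugeField.plaqHol V p)

/-- `dev` unfolded. [cite: Balaban1985UV3, (7) p.257] -/
theorem dev_apply {G : Type*} [GaugeGroup G] {j : ℕ} (V : GaugeField P j G) (p : Plaq P j) :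
    dev V p = dist1 (GaugeField.plaqHol V p) := rfl

open scoped Classical in
/-- «on the domain Ω_k^{(k)} only» (p. 266: «a decomposition of unity (7), but on the domain Ω₁^{(1)} only»; p. 267: «(7) for the
field V on the domain Λ_k» with `Λ_k = Ω_k^{(k)}` at that point): the finite set of plaquettes of `T^{(j)}` all of whose corners lie
in `Ω_j` — the reading of «the plaquettes of the domain» used for `zetaPrinted`. [cite: Balaban1985UV3, p.266; p.267] -/
def plaqsIn (j : ℕ) (Ωj : Set (Site P 0)) : Finset (Plaq P j) :=
  Finset.univ.filter fun p => cornerSet j p ⊆ Ωj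

/-- Membership in `plaqsIn`. [cite: Balaban1985UV3, p.267] -/
theorem mem_plaqsIn_iff {j : ℕ} {Ωj : Set (Site P 0)} {p : Plaq P j} : p ∈ plaqsIn j Ωj ↔ cornerSet j p ⊆ Ωj := by
  classical
  simp [plaqsIn]

variable {G : Type*} [GaugeGroup G]

open scoped Classical in
variable (P) in
/-- **`ζ_{Λ_j}` WITH A BODY** (p. 266: «functions ζ_{Λ_j} are defined in the same way as ζ_{Ω₁ᶜ} on configurations V_j restricted
to Λ_j»; p. 268: «The partial resummation over admissible P gives the function ζ_{Λ_k}»): the cell's `B10Decomposition7.zetaDom`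
— seat p23's body of `ζ_{Ω₁ᶜ}` in (8), `Σ_{P ⊆ T, Ω_{j+1}(P) = Ω′} Π_{p∈P} χ_≥(p) · Π_{p∈T∖P, p not cornered in Ω′} χ_<(p)` — with
the 0/1 characteristic functions of (7) at threshold `ε₁` and deviations `dev V_j`, the torus rule `P ↦ Ω_{j+1}(P)` of §4
(`plaqRule`, previous domain `Ω_j`) and `χ_{Ω′}` ranging over the plaquettes of `T` with a corner in `Ω′` (the cell's
`B10Decomposition7.cornered` at `cornerSet`).  `T` = the plaquette set on which (7) is applied (print: `plaqsIn j Ω_j`), `Ω′` =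
the admissible new domain `Ω_{j+1}`. [cite: Balaban1985UV3, (40) p.266; p.268; (8) p.258] -/
def zetaΛ (M₁ : ℕ) (R : ℕ → ℝ) (j : ℕ) (Ωj : Set (Site P 0)) (T : Finset (Plaq P j)) (ε₁ : ℝ) (V : GaugeField P j G)
    (Ω' : Set (Site P 0)) : ℝ :=
  B10Decomposition7.zetaDom T (B10Decomposition7.chiGe ε₁ (dev V)) (B10Decomposition7.chiLt ε₁ (dev V))
    (plaqRule P M₁ R j Ωj) (B10Decomposition7.cornered (cornerSet j) T) Ω'

open scoped Classical in
/-- `χ_{Ω′}` of (8) at the passage `j → j+1` (p. 268: «the small fields characteristic function on a neighbourhood of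
B(Λ_{k+1})»; p. 258: «plaquettes with at least one corner belonging to Ω₁»): the product of `χ({|V_j(∂p) − 1| < ε₁})` over the
plaquettes of `T` with a corner in `Ω′` — the cell's `B10Decomposition7.chiDom`. [cite: Balaban1985UV3, (8) p.258; p.268] -/
def chiΩ (j : ℕ) (T : Finset (Plaq P j)) (ε₁ : ℝ) (V : GaugeField P j G) (Ω' : Set (Site P 0)) : ℝ :=
  B10Decomposition7.chiDom (B10Decomposition7.chiLt ε₁ (dev V)) (B10Decomposition7.cornered (cornerSet j) T) Ω'

/-- Membership in the cell's `B10Decomposition7.cornered` («plaquettes with at least one corner belonging to Ω₁», p. 258),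
unfolded once over abstract carriers (so that the classical instances of its body are the ones found).
[cite: Balaban1985UV3, (8) p.258] -/
theorem mem_cornered_iff {Pl Pt : Type*} (corners : Pl → Set Pt) (T : Finset Pl) (Ω : Set Pt) (p : Pl) :
    p ∈ B10Decomposition7.cornered corners T Ω ↔ p ∈ T ∧ ∃ y ∈ corners p, y ∈ Ω := by
  classical
  unfold B10Decomposition7.cornered
  rw [Finset.mem_filter]

open scoped Classical in
/-- «By this definition p ⊂ Ω₁ᶜ» (p. 257) on the torus, as the separation the resummation needs: for `R(g_j)M₁ ≥ 0` no plaquette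
of `P` has a corner in `Ω_{j+1}(P)` (such a corner would be at block distance `0 < R(g_j)M₁ < 0` from itself).
[cite: Balaban1985UV3, p.257; (8) p.258] -/
theorem disjoint_cornered_plaqRule {M₁ : ℕ} {R : ℕ → ℝ} {j : ℕ} (hR : 0 ≤ R j * M₁) (Ωj : Set (Site P 0))
    (T S : Finset (Plaq P j)) : Disjoint S (B10Decomposition7.cornered (cornerSet j) T (plaqRule P M₁ R j Ωj S)) := by
  rw [Finset.disjoint_left]
  intro p hpS hpc
  obtain ⟨y, hy, hyΩ⟩ := ((mem_cornered_iff _ T _ p).mp hpc).2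
  exact Set.disjoint_left.mp (disjoint_ruleDom hR Ωj (cornerPts j S)) (cornerSet_subset_cornerPts hpS hy) hyΩ

open scoped Classical in
/-- The same separation in the one-inclusion form `star (Ω_{j+1}(P)) ⊆ T ∖ P` used by the cell's §5 theorems.
[cite: Balaban1985UV3, p.257; (8) p.258] -/
theorem cornered_plaqRule_subset_sdiff {M₁ : ℕ} {R : ℕ → ℝ} {j : ℕ} (hR : 0 ≤ R j * M₁) (Ωj : Set (Site P 0))
    (T : Finset (Plaq P j)) : ∀ S, S ⊆ T → B10Decomposition7.cornered (cornerSet j) T (plaqRule P M₁ R j Ωj S) ⊆ T \ S :=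
  fun S _ => Finset.subset_sdiff.mpr
    ⟨B10Decomposition7.cornered_subset _ T _, (disjoint_cornered_plaqRule hR Ωj T S).symm⟩

open scoped Classical in
/-- **(8) at the passage `j → j+1` ON THE TORUS** (p. 268: «The partial resummation over admissible P gives the function ζ_{Λ_k}
defined on fields V_k restricted to Λ_k, and the small fields characteristic function on a neighbourhood of B(Λ_{k+1})»; (8)
p. 258: «1 = Σ_{admissible Ω₁} ζ_{Ω₁ᶜ} χ_{Ω₁}»): for every configuration `V_j`, every threshold `ε₁`, every plaquette set `T` and
previous domain `Ω_j`, `Σ_{admissible Ω_{j+1}} ζ_{Λ_j}(Ω_{j+1})(V_j) · χ_{Ω_{j+1}}(V_j) = 1` with THE PRINTED RULE — an instance of the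
cell's `B10Decomposition7.resummation8` (needs `R(g_j)M₁ ≥ 0`). PROVED. [cite: Balaban1985UV3, (8) p.258; p.268] -/
theorem resummation48_torus {M₁ : ℕ} {R : ℕ → ℝ} {j : ℕ} (hR : 0 ≤ R j * M₁) (Ωj : Set (Site P 0))
    (T : Finset (Plaq P j)) (ε₁ : ℝ) (V : GaugeField P j G) :
    ∑ Ω' ∈ B10Decomposition7.admissible T (plaqRule P M₁ R j Ωj),
      zetaΛ P M₁ R j Ωj T ε₁ V Ω' * chiΩ j T ε₁ V Ω' = 1 :=
  B10Decomposition7.resummation8 T _ _ (plaqRule P M₁ R j Ωj) (B10Decomposition7.cornered (cornerSet j) T)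
    (fun p _ => B10Decomposition7.chiGe_add_chiLt ε₁ (dev V) p)
    (fun _ _ => B10Decomposition7.cornered_subset _ T _) (fun S _ => disjoint_cornered_plaqRule hR Ωj T S)

open scoped Classical in
/-- **Locality of `ζ_{Λ_j}`** (p. 268: «ζ_{Λ_k} defined on fields V_k restricted to Λ_k»; p. 266: «on configurations V_j restricted
to Λ_j»): `ζ_{Λ_j}(Ω_{j+1})` depends on the configuration ONLY through the plaquette variables `V_j(∂p)` of the plaquettes of `T` with
NO corner in `Ω_{j+1}` — two configurations with the same deviations there give the same value (an instance of the cell's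
`B10Decomposition7.zetaDom_congr_off_star`; with `T = plaqsIn j Ω_j` these are the plaquettes of `Ω_j^{(j)}` not cornered in
`Ω_{j+1}^{(j)}`). PROVED. [cite: Balaban1985UV3, (40) p.266; p.268] -/
theorem zetaΛ_local {M₁ : ℕ} {R : ℕ → ℝ} {j : ℕ} (hR : 0 ≤ R j * M₁) (Ωj : Set (Site P 0)) (T : Finset (Plaq P j))
    (ε₁ : ℝ) {V V' : GaugeField P j G} (Ω' : Set (Site P 0))
    (h : ∀ p ∈ T, p ∉ B10Decomposition7.cornered (cornerSet j) T Ω' → dev V p = dev V' p) :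
    zetaΛ P M₁ R j Ωj T ε₁ V Ω' = zetaΛ P M₁ R j Ωj T ε₁ V' Ω' :=
  B10Decomposition7.zetaDom_congr_off_star T _ _ _ _ (plaqRule P M₁ R j Ωj)
    (B10Decomposition7.cornered (cornerSet j) T) (cornered_plaqRule_subset_sdiff hR Ωj T) Ω'
    (fun p hp hps => by simp only [B10Decomposition7.chiGe, h p hp hps])
    (fun p hp hps => by simp only [B10Decomposition7.chiLt, h p hp hps])

open scoped Classical in
/-- Locality at the level of the plaquette variables themselves: configurations with the same `V_j(∂p)` on the plaquettes of `T`
not cornered in `Ω_{j+1}` have the same `ζ_{Λ_j}(Ω_{j+1})`. [cite: Balaban1985UV3, (40) p.266; p.268] -/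
theorem zetaΛ_local_plaqHol {M₁ : ℕ} {R : ℕ → ℝ} {j : ℕ} (hR : 0 ≤ R j * M₁) (Ωj : Set (Site P 0))
    (T : Finset (Plaq P j)) (ε₁ : ℝ) {V V' : GaugeField P j G} (Ω' : Set (Site P 0))
    (h : ∀ p ∈ T, p ∉ B10Decomposition7.cornered (cornerSet j) T Ω' →
      GaugeField.plaqHol V p = GaugeField.plaqHol V' p) :
    zetaΛ P M₁ R j Ωj T ε₁ V Ω' = zetaΛ P M₁ R j Ωj T ε₁ V' Ω' :=
  zetaΛ_local hR Ωj T ε₁ Ω' fun p hp hps => by rw [dev_apply, dev_apply, h p hp hps]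

open scoped Classical in
/-- `χ_{Ω′}(V_j) = 1` iff every plaquette of `T` with a corner in `Ω′` is small, `|V_j(∂p) − 1| < ε₁` («plaquette variables of
field configurations are small in a neighbourhood of Ω₁», p. 257). [cite: Balaban1985UV3, p.257; (8) p.258] -/
theorem chiΩ_eq_one_iff {j : ℕ} (T : Finset (Plaq P j)) (ε₁ : ℝ) (V : GaugeField P j G) (Ω' : Set (Site P 0)) :
    chiΩ j T ε₁ V Ω' = 1 ↔
      ∀ p ∈ B10Decomposition7.cornered (cornerSet j) T Ω', dist1 (GaugeField.plaqHol V p) < ε₁ := by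
  unfold chiΩ B10Decomposition7.chiDom B10Decomposition7.chiLt dev
  constructor
  · intro h p hp
    by_contra hlt
    have h0 : (∏ q ∈ B10Decomposition7.cornered (cornerSet j) T Ω',
        if dist1 (GaugeField.plaqHol V q) < ε₁ then (1 : ℝ) else 0) = 0 :=
      Finset.prod_eq_zero hp (by rw [if_neg hlt])
    rw [h0] at h
    exact zero_ne_one h
  · intro h
    exact Finset.prod_eq_one fun p hp => by rw [if_pos (h p hp)]

open scoped Classical in
/-- `χ_{Ω′}(V_j) = 0` iff some plaquette of `T` with a corner in `Ω′` is NOT small. [cite: Balaban1985UV3, p.257; (8) p.258] -/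
theorem chiΩ_eq_zero_iff {j : ℕ} (T : Finset (Plaq P j)) (ε₁ : ℝ) (V : GaugeField P j G) (Ω' : Set (Site P 0)) :
    chiΩ j T ε₁ V Ω' = 0 ↔
      ∃ p ∈ B10Decomposition7.cornered (cornerSet j) T Ω', ¬ dist1 (GaugeField.plaqHol V p) < ε₁ := by
  unfold chiΩ B10Decomposition7.chiDom B10Decomposition7.chiLt dev
  rw [Finset.prod_eq_zero_iff]
  refine exists_congr fun p => and_congr_right fun _ => ?_
  constructor
  · intro h hlt
    rw [if_pos hlt] at h
    exact one_ne_zero h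
  · intro h
    rw [if_neg h]

open scoped Classical in
/-- `χ_{Ω′}` IS the cell's small-field characteristic function `Setup.chiSmall` of the plaquettes of `T` cornered in `Ω′` at
threshold `ε₁` (so the (8)-factor `χ_{Ω_{j+1}}` is a `Density`-factor of the same kind as (4)/(40)'s `chi4`/`chi40` of
`…B10Eq2DensityTower`). [cite: Balaban1985UV3, (8) p.258; (40) p.266] -/
theorem chiΩ_eq_chiSmall {j : ℕ} (T : Finset (Plaq P j)) (ε₁ : ℝ) (V : GaugeField P j G) (Ω' : Set (Site P 0)) :
    chiΩ j T ε₁ V Ω' = chiSmall (↑(B10Decomposition7.cornered (cornerSet j) T Ω') : Set (Plaq P j)) ε₁ V := by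
  unfold chiSmall PlaqSmallOn
  by_cases hc : ∀ p ∈ (↑(B10Decomposition7.cornered (cornerSet j) T Ω') : Set (Plaq P j)),
      dist1 (GaugeField.plaqHol V p) < ε₁
  · rw [if_pos hc]
    exact (chiΩ_eq_one_iff T ε₁ V Ω').mpr fun p hp => hc p (Finset.mem_coe.mpr hp)
  · rw [if_neg hc]
    push Not at hc
    obtain ⟨p, hp, hlt⟩ := hc
    exact (chiΩ_eq_zero_iff T ε₁ V Ω').mpr ⟨p, Finset.mem_coe.mp hp, not_lt.mpr hlt⟩

open scoped Classical in
/-- **The admissible `Ω_{j+1}`** (p. 268 «admissible P»; (8) «admissible Ω₁» = the domains `Ω_{j+1}(P)`, `P ⊆ T`): each is a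
union of the scale-`j` big blocks, lies in `Ω_j`, and is (39)-separated from `Ω_jᶜ` — so taking, in each term, `Ω_{j+1}` := the
admissible domain of that term yields «a sequence of domains Ω₁ ⊃ Ω₂ ⊃ … ⊃ Ω_k … satisfying the conditions (39)» (§4's
`ruleSeq` with `F j = cornerPts j P_j`: `omegaSeq_succ_eq_plaqRule`). [cite: Balaban1985UV3, (38)–(39) p.266; p.268] -/
theorem admissible_props {M₁ : ℕ} {R : ℕ → ℝ} {j : ℕ} (hR : 0 ≤ R j * M₁) (Ωj : Set (Site P 0)) (T : Finset (Plaq P j))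
    {Ω' : Set (Site P 0)} (hΩ' : Ω' ∈ B10Decomposition7.admissible T (plaqRule P M₁ R j Ωj)) :
    IsBlockUnion (M₁ * P.L ^ j) Ω' ∧ Ω' ⊆ Ωj ∧
      ∀ x y : Site P 0, x ∉ Ωj → y ∈ Ω' → R j * M₁ < (Site.tdist x y : ℝ) / (P.L : ℝ) ^ j := by
  classical
  unfold B10Decomposition7.admissible at hΩ'
  obtain ⟨S, -, rfl⟩ := Finset.mem_image.mp hΩ'
  exact ⟨isBlockUnion_plaqRule M₁ R j Ωj S, plaqRule_subset hR Ωj S, fun x y hx hy => sep_plaqRule hx hy⟩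

open scoped Classical in
/-- The domain `Ω_{j+1}(P)` of every `P ⊆ T` is admissible (the cell's `dom_mem_admissible`). [cite: Balaban1985UV3, (8) p.258; p.268] -/
theorem plaqRule_mem_admissible (M₁ : ℕ) (R : ℕ → ℝ) (j : ℕ) (Ωj : Set (Site P 0)) {T S : Finset (Plaq P j)}
    (hS : S ⊆ T) : plaqRule P M₁ R j Ωj S ∈ B10Decomposition7.admissible T (plaqRule P M₁ R j Ωj) :=
  B10Decomposition7.dom_mem_admissible T _ hS

/-- §4's generated sequence with the large-field point sets taken from plaquette sets `P_j ⊂ T^{(j)}`: `Ω_{j+1}` is the torus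
rule applied to `P_j` — the admissible domain of the `P_j`-term. (definitional) [cite: Balaban1985UV3, (38) p.266; p.268] -/
theorem omegaSeq_succ_eq_plaqRule (M₁ : ℕ) (R : ℕ → ℝ) (Ω₀ : Set (Site P 0)) (S : (j : ℕ) → Finset (Plaq P j)) (j : ℕ) :
    omegaSeq P M₁ R Ω₀ (fun i => cornerPts i (S i)) (j + 1) =
      plaqRule P M₁ R j (omegaSeq P M₁ R Ω₀ (fun i => cornerPts i (S i)) j) (S j) := rfl

variable (P) in
/-- **`ζ_{Λ_j}` at the printed data**: plaquette set = the plaquettes of `Ω_j^{(j)}` (`plaqsIn`), threshold `ε₁ = g_jp(g_j)`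
(p. 267: «with ε₁ = g_kp(g_k)»; `p = B10.pFun b₀ p₀`), along a coupling sequence `g`. [cite: Balaban1985UV3, (40) p.266; p.267] -/
def zetaPrinted (M₁ : ℕ) (R : ℕ → ℝ) (b₀ p₀ : ℝ) (g : ℕ → ℝ) (j : ℕ) (Ωj : Set (Site P 0)) (V : GaugeField P j G)
    (Ω' : Set (Site P 0)) : ℝ :=
  zetaΛ P M₁ R j Ωj (plaqsIn j Ωj) (g j * B10.pFun b₀ p₀ (g j)) V Ω'

open scoped Classical in
/-- (8) at the passage `j → j+1` with the printed data (`T = plaqsIn j Ω_j`, `ε₁ = g_jp(g_j)`):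
`Σ_{admissible Ω_{j+1}} ζ_{Λ_j} χ_{Ω_{j+1}} = 1`. PROVED. [cite: Balaban1985UV3, (8) p.258; p.268] -/
theorem resummation48_printed {M₁ : ℕ} {R : ℕ → ℝ} {j : ℕ} (hR : 0 ≤ R j * M₁) (b₀ p₀ : ℝ) (g : ℕ → ℝ)
    (Ωj : Set (Site P 0)) (V : GaugeField P j G) :
    ∑ Ω' ∈ B10Decomposition7.admissible (plaqsIn j Ωj) (plaqRule P M₁ R j Ωj),
      zetaPrinted P M₁ R b₀ p₀ g j Ωj V Ω' * chiΩ j (plaqsIn j Ωj) (g j * B10.pFun b₀ p₀ (g j)) V Ω' = 1 :=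
  resummation48_torus hR Ωj (plaqsIn j Ωj) _ V

end Zeta

/-! ## §6 (v1.1, APPEND-ONLY) Print's letter for the rule's distance: SITE-to-block («distances to P ∪ Ω_k^{(k)c}» of a block)

Second-reader note L-49 (r10, SECOND-READ-B10 pass 42, 2026-08-23): §3–§4 measure the rule's distance BLOCK-to-BLOCK (`bdist j x y` =
distance between the scale-`j` cubes of `x` and `y`, as the cell's abstract `DomainSeq` docstring words it), while print's «big blocks …
with distances to P ∪ Ω_k^{(k)c} greater than R(g_k)M₁» (p. 268; p. 257 «their distances to P are > RM₁») is the distance from a BLOCK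
to a POINT SET, i.e. site-to-block after the minimum over the set.  Since `dist(block x, block y) ≤ dist(x, block y)`, §4's `ruleDom` is
a SUB-union of print's maximal union (strictly smaller when the scale-`j` cube of a point of `P ∪ Ω_jᶜ` reaches closer); (38)/(39) hold
for both and for every sub-union (`rule268_of_subset_ruleDom`).  This section types print's letter as a second instance — every §1–§5
declaration is byte-identical to v1 — with the same theorems by name: `siteBlockDist`, `bdistPt`, `torusSeqPt`, `ruleDomPt` (THE union of
print), `omegaSeqPt`, `ruleSeqPt`, `plaqRulePt`, `zetaΛPt`; the comparison `ruleDom ⊆ ruleDomPt`; and (39) printed ⇔ block form, which for the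
site-to-block distance needs only the `Ω_{j+1}` to be block unions — HYPOTHESIS-FREE for this rule's sequence
(`sep39_ruleSeqPt_iff_printed`; §3's `sep39_iff_printed` needs `Ω_j` as well). -/

section PrintLetter

variable {n : ℕ}

/-- A cube of side `1` is a single site: the side-`1` label determines the site (`ZMod.val` is injective).
(elementary; serves (39)) [cite: Balaban1985UV3, (39) p.266] -/
theorem eq_of_cubeIdx_one_eq {x y : Site P n} (h : cubeIdx 1 x = cubeIdx 1 y) : x = y := by
  funext μ
  apply ZMod.val_injective
  have hμ : (x μ).val / 1 = (y μ).val / 1 := congrFun h μ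
  simpa using hμ

variable (P n) in
/-- **The distance of the rule, print's letter** (p. 268 «big blocks … with distances to P ∪ Ω_k^{(k)c} greater than R(g_k)M₁»; p. 257
«such that their distances to P are > RM₁»): the least torus distance, in lattice steps, between the SITE `x` and the big block (cube
of side `s`) containing `y` — the cell's cube distance `cdist` between the one-site cube of `x` (side `1`) and the cube of `y`; the
distance from a block to a point SET is the minimum of these over the set. [cite: Balaban1985UV3, p.268; p.257; (39) p.266] -/
def siteBlockDist (s : ℕ) (x y : Site P n) : ℕ := cdist P n 1 s (cubeIdx 1 x) (cubeIdx s y)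

/-- The site-to-block distance is at most the site distance. (elementary; serves (39)) [cite: Balaban1985UV3, (39) p.266] -/
theorem siteBlockDist_le_tdist (s : ℕ) (x y : Site P n) : siteBlockDist P n s x y ≤ Site.tdist x y :=
  B3Ineq314Cubes.cdist_le_tdist 1 s x y

/-- A site is at distance `0` from its own block. (elementary; serves (39)) [cite: Balaban1985UV3, (39) p.266] -/
theorem siteBlockDist_self (s : ℕ) (x : Site P n) : siteBlockDist P n s x x = 0 :=
  Nat.eq_zero_of_le_zero (le_of_le_of_eq (siteBlockDist_le_tdist s x x) (tdist_self x))

/-- The site-to-block distance depends on `y` only through its block. (elementary; serves (39)) [cite: Balaban1985UV3, (39) p.266] -/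
theorem siteBlockDist_congr_right {s : ℕ} (x : Site P n) {y y' : Site P n} (hy : cubeIdx s y = cubeIdx s y') :
    siteBlockDist P n s x y = siteBlockDist P n s x y' := by
  unfold siteBlockDist
  rw [hy]

/-- The site-to-block distance is ATTAINED at some site of the block of `y`. (elementary; serves (39)) [cite: Balaban1985UV3, (39) p.266] -/
theorem siteBlockDist_attained (s : ℕ) (x y : Site P n) :
    ∃ y' : Site P n, cubeIdx s y' = cubeIdx s y ∧ Site.tdist x y' = siteBlockDist P n s x y := by
  have hne : {m : ℕ | ∃ x' y' : Site P n, cubeIdx 1 x' = cubeIdx 1 x ∧ cubeIdx s y' = cubeIdx s y ∧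
      Site.tdist x' y' = m}.Nonempty := ⟨_, x, y, rfl, rfl, rfl⟩
  obtain ⟨x', y', hx', hy', h⟩ := Nat.sInf_mem hne
  obtain rfl : x' = x := eq_of_cubeIdx_one_eq hx'
  exact ⟨y', hy', h⟩

/-- Block-to-block ≤ site-to-block: `dist(block x, block y) ≤ dist(x, block y)` — a lower bound on the former (§4's `ruleDom`) is a
STRONGER requirement than print's on the latter (note L-49). (elementary; serves (39)) [cite: Balaban1985UV3, (39) p.266; p.268] -/
theorem blockDist_le_siteBlockDist (s : ℕ) (x y : Site P n) : blockDist P n s x y ≤ siteBlockDist P n s x y := by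
  obtain ⟨y', hy', hd⟩ := siteBlockDist_attained s x y
  rw [← hd, ← blockDist_congr (rfl : cubeIdx s x = cubeIdx s x) hy']
  exact blockDist_le_tdist s x y'

/-- Pointwise separation ⇒ site-to-block separation: if `x` is more than `c` steps from every site of a block-union set `Y ∋ y`, then
`x` is more than `c` from the block of `y`. (elementary; serves (39)) [cite: Balaban1985UV3, (39) p.266] -/
theorem lt_siteBlockDist_of_forall {s : ℕ} {Y : Set (Site P n)} (hY : IsBlockUnion s Y) {c : ℝ} {x : Site P n}
    (h : ∀ y' ∈ Y, c < (Site.tdist x y' : ℝ)) {y : Site P n} (hy : y ∈ Y) : c < (siteBlockDist P n s x y : ℝ) := by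
  obtain ⟨y', hy', hd⟩ := siteBlockDist_attained s x y
  rw [← hd]
  exact h y' ((hY hy').mpr hy)

/-- The scale-`j` block pseudo-distance of PRINT'S LETTER on `T_η = Site P 0`: «(Lʲη)⁻¹dist» from the site `x` to the big block of
`T₁^{(j)}` (side `M₁Lʲ` fine steps) containing `y` (so «∀ x ∈ S, c < bdistPt j x y» IS «(Lʲη)⁻¹dist(block(y), S) > c»).
[cite: Balaban1985UV3, p.268; (39) p.266] -/
def bdistPt (P : Params) (M₁ : ℕ) (j : ℕ) (x y : Site P 0) : ℝ :=
  (siteBlockDist P 0 (M₁ * P.L ^ j) x y : ℝ) / (P.L : ℝ) ^ j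

/-- `bdistPt j x x = 0`. (elementary; serves (39)) [cite: Balaban1985UV3, (39) p.266] -/
theorem bdistPt_self (M₁ j : ℕ) (x : Site P 0) : bdistPt P M₁ j x x = 0 := by
  simp [bdistPt, siteBlockDist_self]

/-- `0 ≤ bdistPt`. (elementary; serves (39)) [cite: Balaban1985UV3, (39) p.266] -/
theorem bdistPt_nonneg (M₁ j : ℕ) (x y : Site P 0) : 0 ≤ bdistPt P M₁ j x y := by
  unfold bdistPt
  positivity

/-- `bdistPt j x y` depends on `y` only through its scale-`j` big block. (elementary; serves (39)) [cite: Balaban1985UV3, (39) p.266] -/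
theorem bdistPt_congr_right {M₁ j : ℕ} (x : Site P 0) {y y' : Site P 0}
    (hy : cubeIdx (M₁ * P.L ^ j) y = cubeIdx (M₁ * P.L ^ j) y') : bdistPt P M₁ j x y = bdistPt P M₁ j x y' := by
  unfold bdistPt
  rw [siteBlockDist_congr_right x hy]

/-- `bdistPt j x y ≤ (Lʲ)⁻¹|x − y|`. (elementary; serves (39)) [cite: Balaban1985UV3, (39) p.266] -/
theorem bdistPt_le_tdist_div (M₁ j : ℕ) (x y : Site P 0) :
    bdistPt P M₁ j x y ≤ (Site.tdist x y : ℝ) / (P.L : ℝ) ^ j := by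
  unfold bdistPt
  exact div_le_div_of_nonneg_right (by exact_mod_cast siteBlockDist_le_tdist _ x y) (by positivity)

/-- §3's block-to-block `bdist` is below print's `bdistPt`. (elementary; serves (39)) [cite: Balaban1985UV3, (39) p.266; p.268] -/
theorem bdist_le_bdistPt (M₁ j : ℕ) (x y : Site P 0) : bdist P M₁ j x y ≤ bdistPt P M₁ j x y := by
  unfold bdist bdistPt
  exact div_le_div_of_nonneg_right (by exact_mod_cast blockDist_le_siteBlockDist _ x y) (by positivity)

variable (P) in
/-- **The torus instance of `B10LargeField.DomainSeq` at print's letter**: as `torusSeq`, with the site-to-block pseudo-distance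
`bdistPt`. [cite: Balaban1985UV3, (38)–(39) p.266; p.268] -/
def torusSeqPt (M₁ : ℕ) (R : ℕ → ℝ) (Ω F : ℕ → Set (Site P 0)) : DomainSeq where
  Pt := Site P 0
  Ω := Ω
  P := F
  bdist := bdistPt P M₁
  bdist_self := fun j x => bdistPt_self M₁ j x
  collar := fun j => R j * M₁

/-- The block form `B10LargeField.Sep39` on `torusSeqPt` IMPLIES (39) as printed. [cite: Balaban1985UV3, (39) p.266] -/
theorem sep39Printed_of_sep39Pt {M₁ : ℕ} {R : ℕ → ℝ} {Ω F : ℕ → Set (Site P 0)} (h : Sep39 (torusSeqPt P M₁ R Ω F)) :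
    Sep39Printed M₁ R Ω :=
  fun j x y hx hy => lt_of_lt_of_le (h j x y hx hy) (bdistPt_le_tdist_div M₁ j x y)

/-- Conversely (39) as printed IMPLIES the block form on `torusSeqPt` as soon as each `Ω_{j+1}` is a union of the big blocks of
`T₁^{(j)}` (the site-to-block distance is attained inside the same block ⊆ `Ω_{j+1}`); NO hypothesis on `Ω_j`. [cite: Balaban1985UV3, (39) p.266] -/
theorem sep39Pt_of_sep39Printed {M₁ : ℕ} {R : ℕ → ℝ} {Ω F : ℕ → Set (Site P 0)}
    (hΩ' : ∀ j, IsBlockUnion (M₁ * P.L ^ j) (Ω (j + 1))) (h : Sep39Printed M₁ R Ω) : Sep39 (torusSeqPt P M₁ R Ω F) := by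
  intro j x y hx hy
  show R j * M₁ < (siteBlockDist P 0 (M₁ * P.L ^ j) x y : ℝ) / (P.L : ℝ) ^ j
  have hL : (0 : ℝ) < (P.L : ℝ) ^ j := by
    have := P.L_pos
    positivity
  rw [lt_div_iff₀ hL]
  refine lt_siteBlockDist_of_forall (hΩ' j) (c := R j * M₁ * (P.L : ℝ) ^ j) ?_ hy
  intro y' hy'
  exact (lt_div_iff₀ hL).mp (h j x y' hx hy')

/-- **(39): printed form ⇔ block form** on `torusSeqPt`, for sequences whose `Ω_{j+1}` are block unions. [cite: Balaban1985UV3, (39) p.266] -/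
theorem sep39Pt_iff_printed {M₁ : ℕ} {R : ℕ → ℝ} {Ω F : ℕ → Set (Site P 0)}
    (hΩ' : ∀ j, IsBlockUnion (M₁ * P.L ^ j) (Ω (j + 1))) : Sep39 (torusSeqPt P M₁ R Ω F) ↔ Sep39Printed M₁ R Ω :=
  ⟨sep39Printed_of_sep39Pt, sep39Pt_of_sep39Printed hΩ'⟩

/-- **The rule AT PRINT'S LETTER** (p. 268): `Ω_{j+1}` = THE union of the big blocks `B` of `T₁^{(j)}` with `(Lʲη)⁻¹dist(B, F ∪ Ω_jᶜ) >
R(g_j)M₁` — site-to-block distances from every point of `F` and every point outside `Ω_j`. [cite: Balaban1985UV3, p.268; p.257] -/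
def ruleDomPt (P : Params) (M₁ : ℕ) (R : ℕ → ℝ) (j : ℕ) (Ωj F : Set (Site P 0)) : Set (Site P 0) :=
  {y | ∀ x : Site P 0, (x ∈ F ∨ x ∉ Ωj) → R j * M₁ < bdistPt P M₁ j x y}

/-- Membership in `ruleDomPt`, unfolded. [cite: Balaban1985UV3, p.268] -/
theorem mem_ruleDomPt_iff {M₁ : ℕ} {R : ℕ → ℝ} {j : ℕ} {Ωj F : Set (Site P 0)} {y : Site P 0} :
    y ∈ ruleDomPt P M₁ R j Ωj F ↔ ∀ x : Site P 0, (x ∈ F ∨ x ∉ Ωj) → R j * M₁ < bdistPt P M₁ j x y := Iff.rfl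

/-- **§4's `ruleDom` is a sub-union of print's `ruleDomPt`** (note L-49: the block-to-block condition is the stronger one).
[cite: Balaban1985UV3, p.268] -/
theorem ruleDom_subset_ruleDomPt (M₁ : ℕ) (R : ℕ → ℝ) (j : ℕ) (Ωj F : Set (Site P 0)) :
    ruleDom P M₁ R j Ωj F ⊆ ruleDomPt P M₁ R j Ωj F :=
  fun y hy x hx => lt_of_lt_of_le (hy x hx) (bdist_le_bdistPt M₁ j x y)

/-- `ruleDomPt` IS a union of the scale-`j` big blocks. [cite: Balaban1985UV3, p.268; (39) p.266] -/
theorem isBlockUnion_ruleDomPt (M₁ : ℕ) (R : ℕ → ℝ) (j : ℕ) (Ωj F : Set (Site P 0)) :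
    IsBlockUnion (M₁ * P.L ^ j) (ruleDomPt P M₁ R j Ωj F) := by
  intro y y' hyy'
  simp only [mem_ruleDomPt_iff]
  constructor
  · intro h x hx
    rw [← bdistPt_congr_right x hyy']
    exact h x hx
  · intro h x hx
    rw [bdistPt_congr_right x hyy']
    exact h x hx

/-- `ruleDomPt ⊆ Ω_j` when `R(g_j)M₁ ≥ 0` ((38)). [cite: Balaban1985UV3, (38) p.266] -/
theorem ruleDomPt_subset {M₁ : ℕ} {R : ℕ → ℝ} {j : ℕ} (hR : 0 ≤ R j * M₁) (Ωj F : Set (Site P 0)) :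
    ruleDomPt P M₁ R j Ωj F ⊆ Ωj := by
  intro y hy
  by_contra hyΩ
  have h := hy y (Or.inr hyΩ)
  rw [bdistPt_self] at h
  exact absurd h (not_lt.mpr hR)

/-- «in fact dist(P, Ω₁) > RM₁»: the large-field points avoid `ruleDomPt` when `R(g_j)M₁ ≥ 0`. [cite: Balaban1985UV3, p.257] -/
theorem disjoint_ruleDomPt {M₁ : ℕ} {R : ℕ → ℝ} {j : ℕ} (hR : 0 ≤ R j * M₁) (Ωj F : Set (Site P 0)) :
    Disjoint F (ruleDomPt P M₁ R j Ωj F) := by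
  rw [Set.disjoint_left]
  intro x hxF hx
  have h := hx x (Or.inl hxF)
  rw [bdistPt_self] at h
  exact absurd h (not_lt.mpr hR)

/-- The sequence generated by the rule at print's letter. [cite: Balaban1985UV3, (38) p.266; p.268] -/
def omegaSeqPt (P : Params) (M₁ : ℕ) (R : ℕ → ℝ) (Ω₀ : Set (Site P 0)) (F : ℕ → Set (Site P 0)) : ℕ → Set (Site P 0)
  | 0 => Ω₀
  | j + 1 => ruleDomPt P M₁ R j (omegaSeqPt P M₁ R Ω₀ F j) (F j)

/-- `omegaSeqPt` at `0`. [cite: Balaban1985UV3, (38) p.266] -/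
@[simp] theorem omegaSeqPt_zero (M₁ : ℕ) (R : ℕ → ℝ) (Ω₀ : Set (Site P 0)) (F : ℕ → Set (Site P 0)) :
    omegaSeqPt P M₁ R Ω₀ F 0 = Ω₀ := rfl

/-- `omegaSeqPt` at `j + 1`. [cite: Balaban1985UV3, p.268] -/
theorem omegaSeqPt_succ (M₁ : ℕ) (R : ℕ → ℝ) (Ω₀ : Set (Site P 0)) (F : ℕ → Set (Site P 0)) (j : ℕ) :
    omegaSeqPt P M₁ R Ω₀ F (j + 1) = ruleDomPt P M₁ R j (omegaSeqPt P M₁ R Ω₀ F j) (F j) := rfl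

variable (P) in
/-- The `DomainSeq` record of the print's-letter sequence. [cite: Balaban1985UV3, (38)–(39) p.266; p.268] -/
def ruleSeqPt (M₁ : ℕ) (R : ℕ → ℝ) (Ω₀ : Set (Site P 0)) (F : ℕ → Set (Site P 0)) : DomainSeq :=
  torusSeqPt P M₁ R (omegaSeqPt P M₁ R Ω₀ F) F

/-- `Rule268` for the print's-letter sequence — by construction. [cite: Balaban1985UV3, p.268] -/
theorem rule268_ruleSeqPt (M₁ : ℕ) (R : ℕ → ℝ) (Ω₀ : Set (Site P 0)) (F : ℕ → Set (Site P 0)) :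
    Rule268 (ruleSeqPt P M₁ R Ω₀ F) :=
  fun _ _ hy x hx => hy x hx

/-- `Rule268Max` for the print's-letter sequence — THE union of print, by construction. [cite: Balaban1985UV3, p.268] -/
theorem rule268Max_ruleSeqPt (M₁ : ℕ) (R : ℕ → ℝ) (Ω₀ : Set (Site P 0)) (F : ℕ → Set (Site P 0)) :
    Rule268Max (ruleSeqPt P M₁ R Ω₀ F) :=
  fun _ _ hy => hy

/-- **(38)** for the print's-letter sequence — BY NAME from `B10LargeField.nested38_of_rule268`. [cite: Balaban1985UV3, (38) p.266] -/
theorem nested38_ruleSeqPt {M₁ : ℕ} {R : ℕ → ℝ} (hR : ∀ j, 0 ≤ R j * M₁) (Ω₀ : Set (Site P 0)) (F : ℕ → Set (Site P 0)) :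
    Nested38 (ruleSeqPt P M₁ R Ω₀ F) :=
  B10LargeField.nested38_of_rule268 _ hR (rule268_ruleSeqPt M₁ R Ω₀ F)

/-- **(39)**, block form, for the print's-letter sequence — BY NAME from `B10LargeField.sep39_of_rule268`. [cite: Balaban1985UV3, (39) p.266] -/
theorem sep39_ruleSeqPt (M₁ : ℕ) (R : ℕ → ℝ) (Ω₀ : Set (Site P 0)) (F : ℕ → Set (Site P 0)) :
    Sep39 (ruleSeqPt P M₁ R Ω₀ F) :=
  B10LargeField.sep39_of_rule268 _ (rule268_ruleSeqPt M₁ R Ω₀ F)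

/-- **(39) AS PRINTED** for the print's-letter sequence. [cite: Balaban1985UV3, (39) p.266] -/
theorem sep39Printed_ruleSeqPt (M₁ : ℕ) (R : ℕ → ℝ) (Ω₀ : Set (Site P 0)) (F : ℕ → Set (Site P 0)) :
    Sep39Printed M₁ R (omegaSeqPt P M₁ R Ω₀ F) :=
  sep39Printed_of_sep39Pt (sep39_ruleSeqPt M₁ R Ω₀ F)

/-- **(39): block form ⇔ printed form, HYPOTHESIS-FREE** for the print's-letter sequence. [cite: Balaban1985UV3, (39) p.266] -/
theorem sep39_ruleSeqPt_iff_printed (M₁ : ℕ) (R : ℕ → ℝ) (Ω₀ : Set (Site P 0)) (F : ℕ → Set (Site P 0)) :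
    Sep39 (ruleSeqPt P M₁ R Ω₀ F) ↔ Sep39Printed M₁ R (omegaSeqPt P M₁ R Ω₀ F) :=
  sep39Pt_iff_printed fun j => isBlockUnion_ruleDomPt M₁ R j _ _

/-- «a union of big blocks of the lattice T₁^{(k)}» for the print's-letter sequence. [cite: Balaban1985UV3, (39) p.266; p.268] -/
theorem isBlockUnion_omegaSeqPt_succ (M₁ : ℕ) (R : ℕ → ℝ) (Ω₀ : Set (Site P 0)) (F : ℕ → Set (Site P 0)) (j : ℕ) :
    IsBlockUnion (M₁ * P.L ^ j) (omegaSeqPt P M₁ R Ω₀ F (j + 1)) :=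
  isBlockUnion_ruleDomPt M₁ R j _ _

/-- §4's sequence consists of SUB-unions of print's admissible blocks: at every passage, `omegaSeq (j+1) ⊆ ruleDomPt j (omegaSeq j) (F j)`
(the one-step comparison `ruleDom_subset_ruleDomPt` at the common previous domain `omegaSeq j`). The comparison of the two FULL
sequences, `omegaSeq j ⊆ omegaSeqPt j`, follows from this and the monotonicity of the rule in the previous domain — §7
`omegaSeq_subset_omegaSeqPt`. [cite: Balaban1985UV3, p.268] -/
theorem omegaSeq_succ_subset_ruleDomPt (M₁ : ℕ) (R : ℕ → ℝ) (Ω₀ : Set (Site P 0)) (F : ℕ → Set (Site P 0)) (j : ℕ) :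
    omegaSeq P M₁ R Ω₀ F (j + 1) ⊆ ruleDomPt P M₁ R j (omegaSeq P M₁ R Ω₀ F j) (F j) :=
  ruleDom_subset_ruleDomPt M₁ R j _ _

/-- «p ⊂ Ω₁ᶜ» for the print's-letter sequence — BY NAME from `B10LargeField.largeField_subset_Z`. [cite: Balaban1985UV3, p.257; p.273] -/
theorem largeField_subset_Z_ruleSeqPt {M₁ : ℕ} {R : ℕ → ℝ} (hR : ∀ j, 0 ≤ R j * M₁) (Ω₀ : Set (Site P 0))
    (F : ℕ → Set (Site P 0)) (j : ℕ) : F j ⊆ Z (ruleSeqPt P M₁ R Ω₀ F) j :=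
  B10LargeField.largeField_subset_Z _ hR (rule268_ruleSeqPt M₁ R Ω₀ F) j

/-- The collar mechanism for the print's-letter sequence — BY NAME from `B10LargeField.collar_all_scales`.
[cite: Balaban1985UV3, (39) p.266; pp.267–268] -/
theorem collar_all_scales_ruleSeqPt {M₁ : ℕ} {R : ℕ → ℝ} (hR : ∀ j, 0 ≤ R j * M₁) (Ω₀ : Set (Site P 0))
    (F : ℕ → Set (Site P 0)) {i j : ℕ} (hij : i ≤ j) {p : Site P 0} (hp : p ∈ F i) (y : Site P 0)
    (hy : bdistPt P M₁ j p y ≤ R j * M₁) : y ∈ Z (ruleSeqPt P M₁ R Ω₀ F) j :=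
  B10LargeField.collar_all_scales _ hR (rule268_ruleSeqPt M₁ R Ω₀ F) hij hp y hy

/-- Non-vacuity at print's letter: no large fields and `Ω₀ = T_η` ⇒ `Ω_j = T_η`. [cite: Balaban1985UV3, (38) p.266; p.268] -/
theorem omegaSeqPt_univ_of_empty (M₁ : ℕ) (R : ℕ → ℝ) (j : ℕ) :
    omegaSeqPt P M₁ R Set.univ (fun _ => ∅) j = Set.univ := by
  induction j with
  | zero => rfl
  | succ j ih =>
    rw [omegaSeqPt_succ, ih]
    exact Set.eq_univ_of_forall fun _ x hx => by simp at hx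

/-- Sub-unions of print's admissible blocks satisfy `Rule268`, hence (38) and (39). [cite: Balaban1985UV3, p.268; (38)–(39) p.266] -/
theorem rule268_of_subset_ruleDomPt {M₁ : ℕ} {R : ℕ → ℝ} {Ω F : ℕ → Set (Site P 0)}
    (h : ∀ j, Ω (j + 1) ⊆ ruleDomPt P M₁ R j (Ω j) (F j)) : Rule268 (torusSeqPt P M₁ R Ω F) :=
  fun j _ hy x hx => h j hy x hx

/-- (38) for sub-unions of print's admissible blocks — in particular for §4's sequence read in `torusSeqPt`. [cite: Balaban1985UV3, (38) p.266] -/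
theorem nested38_of_subset_ruleDomPt {M₁ : ℕ} {R : ℕ → ℝ} (hR : ∀ j, 0 ≤ R j * M₁) {Ω F : ℕ → Set (Site P 0)}
    (h : ∀ j, Ω (j + 1) ⊆ ruleDomPt P M₁ R j (Ω j) (F j)) : Nested38 (torusSeqPt P M₁ R Ω F) :=
  B10LargeField.nested38_of_rule268 _ hR (rule268_of_subset_ruleDomPt h)

/-- (39), both forms, for sub-unions of print's admissible blocks. [cite: Balaban1985UV3, (39) p.266] -/
theorem sep39_of_subset_ruleDomPt {M₁ : ℕ} {R : ℕ → ℝ} {Ω F : ℕ → Set (Site P 0)}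
    (h : ∀ j, Ω (j + 1) ⊆ ruleDomPt P M₁ R j (Ω j) (F j)) :
    Sep39 (torusSeqPt P M₁ R Ω F) ∧ Sep39Printed M₁ R Ω :=
  have h39 := B10LargeField.sep39_of_rule268 _ (rule268_of_subset_ruleDomPt h)
  ⟨h39, sep39Printed_of_sep39Pt h39⟩

variable (P) in
/-- The rule at print's letter read on plaquette sets (corner points `cornerPts`). [cite: Balaban1985UV3, p.268; p.257] -/
def plaqRulePt (M₁ : ℕ) (R : ℕ → ℝ) (j : ℕ) (Ωj : Set (Site P 0)) (S : Finset (Plaq P j)) : Set (Site P 0) :=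
  ruleDomPt P M₁ R j Ωj (cornerPts j S)

/-- `plaqRule ⊆ plaqRulePt`. [cite: Balaban1985UV3, p.268] -/
theorem plaqRule_subset_plaqRulePt (M₁ : ℕ) (R : ℕ → ℝ) (j : ℕ) (Ωj : Set (Site P 0)) (S : Finset (Plaq P j)) :
    plaqRule P M₁ R j Ωj S ⊆ plaqRulePt P M₁ R j Ωj S :=
  ruleDom_subset_ruleDomPt M₁ R j Ωj _

variable {G : Type*} [GaugeGroup G]

open scoped Classical in
variable (P) in
/-- **`ζ_{Λ_j}` with print's-letter rule**: as `zetaΛ`, with `plaqRulePt` as the assignment `P ↦ Ω_{j+1}(P)`. [cite: Balaban1985UV3, (40) p.266; p.268; (8) p.258] -/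
def zetaΛPt (M₁ : ℕ) (R : ℕ → ℝ) (j : ℕ) (Ωj : Set (Site P 0)) (T : Finset (Plaq P j)) (ε₁ : ℝ) (V : GaugeField P j G)
    (Ω' : Set (Site P 0)) : ℝ :=
  B10Decomposition7.zetaDom T (B10Decomposition7.chiGe ε₁ (dev V)) (B10Decomposition7.chiLt ε₁ (dev V))
    (plaqRulePt P M₁ R j Ωj) (B10Decomposition7.cornered (cornerSet j) T) Ω'

open scoped Classical in
/-- Separation «p ⊂ Ω₁ᶜ» for the print's-letter rule: no plaquette of `P` has a corner in `Ω_{j+1}(P)` (`R(g_j)M₁ ≥ 0`).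
[cite: Balaban1985UV3, p.257; (8) p.258] -/
theorem disjoint_cornered_plaqRulePt {M₁ : ℕ} {R : ℕ → ℝ} {j : ℕ} (hR : 0 ≤ R j * M₁) (Ωj : Set (Site P 0))
    (T S : Finset (Plaq P j)) : Disjoint S (B10Decomposition7.cornered (cornerSet j) T (plaqRulePt P M₁ R j Ωj S)) := by
  rw [Finset.disjoint_left]
  intro p hpS hpc
  obtain ⟨y, hy, hyΩ⟩ := ((mem_cornered_iff _ T _ p).mp hpc).2
  exact Set.disjoint_left.mp (disjoint_ruleDomPt hR Ωj (cornerPts j S)) (cornerSet_subset_cornerPts hpS hy) hyΩ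

open scoped Classical in
/-- **(8) at the passage `j → j+1` ON THE TORUS with print's-letter rule**: `Σ_{admissible Ω_{j+1}} ζ_{Λ_j} χ_{Ω_{j+1}} = 1`. PROVED.
[cite: Balaban1985UV3, (8) p.258; p.268] -/
theorem resummation48_torusPt {M₁ : ℕ} {R : ℕ → ℝ} {j : ℕ} (hR : 0 ≤ R j * M₁) (Ωj : Set (Site P 0))
    (T : Finset (Plaq P j)) (ε₁ : ℝ) (V : GaugeField P j G) :
    ∑ Ω' ∈ B10Decomposition7.admissible T (plaqRulePt P M₁ R j Ωj),
      zetaΛPt P M₁ R j Ωj T ε₁ V Ω' * chiΩ j T ε₁ V Ω' = 1 :=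
  B10Decomposition7.resummation8 T _ _ (plaqRulePt P M₁ R j Ωj) (B10Decomposition7.cornered (cornerSet j) T)
    (fun p _ => B10Decomposition7.chiGe_add_chiLt ε₁ (dev V) p)
    (fun _ _ => B10Decomposition7.cornered_subset _ T _) (fun S _ => disjoint_cornered_plaqRulePt hR Ωj T S)

open scoped Classical in
/-- **Locality of `ζ_{Λ_j}` with print's-letter rule** («ζ_{Λ_k} defined on fields V_k restricted to Λ_k»). PROVED. [cite: Balaban1985UV3, (40) p.266; p.268] -/
theorem zetaΛPt_local {M₁ : ℕ} {R : ℕ → ℝ} {j : ℕ} (hR : 0 ≤ R j * M₁) (Ωj : Set (Site P 0)) (T : Finset (Plaq P j))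
    (ε₁ : ℝ) {V V' : GaugeField P j G} (Ω' : Set (Site P 0))
    (h : ∀ p ∈ T, p ∉ B10Decomposition7.cornered (cornerSet j) T Ω' → dev V p = dev V' p) :
    zetaΛPt P M₁ R j Ωj T ε₁ V Ω' = zetaΛPt P M₁ R j Ωj T ε₁ V' Ω' :=
  B10Decomposition7.zetaDom_congr_off_star T _ _ _ _ (plaqRulePt P M₁ R j Ωj)
    (B10Decomposition7.cornered (cornerSet j) T)
    (fun S _ => Finset.subset_sdiff.mpr
      ⟨B10Decomposition7.cornered_subset _ T _, (disjoint_cornered_plaqRulePt hR Ωj T S).symm⟩) Ω'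
    (fun p hp hps => by simp only [B10Decomposition7.chiGe, h p hp hps])
    (fun p hp hps => by simp only [B10Decomposition7.chiLt, h p hp hps])

open scoped Classical in
/-- **The admissible `Ω_{j+1}` at print's letter**: block unions inside `Ω_j`, (39)-separated from `Ω_jᶜ` in the printed form.
[cite: Balaban1985UV3, (38)–(39) p.266; p.268] -/
theorem admissible_propsPt {M₁ : ℕ} {R : ℕ → ℝ} {j : ℕ} (hR : 0 ≤ R j * M₁) (Ωj : Set (Site P 0)) (T : Finset (Plaq P j))
    {Ω' : Set (Site P 0)} (hΩ' : Ω' ∈ B10Decomposition7.admissible T (plaqRulePt P M₁ R j Ωj)) :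
    IsBlockUnion (M₁ * P.L ^ j) Ω' ∧ Ω' ⊆ Ωj ∧
      ∀ x y : Site P 0, x ∉ Ωj → y ∈ Ω' → R j * M₁ < (Site.tdist x y : ℝ) / (P.L : ℝ) ^ j := by
  classical
  unfold B10Decomposition7.admissible at hΩ'
  obtain ⟨S, -, rfl⟩ := Finset.mem_image.mp hΩ'
  exact ⟨isBlockUnion_ruleDomPt M₁ R j Ωj _, ruleDomPt_subset hR Ωj _,
    fun x y hx hy => lt_of_lt_of_le (hy x (Or.inr hx)) (bdistPt_le_tdist_div M₁ j x y)⟩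

/-- The print's-letter sequence driven by plaquette sets: `Ω_{j+1} = plaqRulePt j Ω_j P_j` (definitional). [cite: Balaban1985UV3, (38) p.266; p.268] -/
theorem omegaSeqPt_succ_eq_plaqRulePt (M₁ : ℕ) (R : ℕ → ℝ) (Ω₀ : Set (Site P 0)) (S : (j : ℕ) → Finset (Plaq P j)) (j : ℕ) :
    omegaSeqPt P M₁ R Ω₀ (fun i => cornerPts i (S i)) (j + 1) =
      plaqRulePt P M₁ R j (omegaSeqPt P M₁ R Ω₀ (fun i => cornerPts i (S i)) j) (S j) := rfl

end PrintLetter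

/-! ## §7 Monotonicity of the rule; §4's sequence lies inside print's (v1.2, B10 second reader's located note L-51)

The p. 268 rule «blocks with distances to `P ∪ Ω_k^{(k)c}` greater than `R M₁`» is MONOTONE in the previous domain `Ω_k` (a larger
previous domain puts fewer sites into `Ω_kᶜ`, hence imposes fewer separation constraints) and ANTITONE in the large-field set `P`,
for both distance readings (§4 block-to-block, §6 site-to-block).  Consequently §4's sequence lies inside print's scale by scale,
`omegaSeq j ⊆ omegaSeqPt j` (induction: `ruleDom_subset_ruleDomPt` + monotonicity), and print's `Z_j` lies inside §4's. -/

section Monotone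

/-- The §4 rule is monotone in the previous domain and antitone in the large-field set. [cite: Balaban1985UV3, p.268] -/
theorem ruleDom_mono {M₁ : ℕ} {R : ℕ → ℝ} {j : ℕ} {Ωj Ωj' F F' : Set (Site P 0)} (hΩ : Ωj ⊆ Ωj') (hF : F' ⊆ F) :
    ruleDom P M₁ R j Ωj F ⊆ ruleDom P M₁ R j Ωj' F' :=
  fun _ hy x hx => hy x (hx.imp (fun h => hF h) (fun h h' => h (hΩ h')))

/-- The print's-letter rule is monotone in the previous domain and antitone in the large-field set. [cite: Balaban1985UV3, p.268] -/
theorem ruleDomPt_mono {M₁ : ℕ} {R : ℕ → ℝ} {j : ℕ} {Ωj Ωj' F F' : Set (Site P 0)} (hΩ : Ωj ⊆ Ωj') (hF : F' ⊆ F) :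
    ruleDomPt P M₁ R j Ωj F ⊆ ruleDomPt P M₁ R j Ωj' F' :=
  fun _ hy x hx => hy x (hx.imp (fun h => hF h) (fun h h' => h (hΩ h')))

/-- Both generated sequences are monotone in the initial domain and antitone in the large-field sets. [cite: Balaban1985UV3, p.268] -/
theorem omegaSeq_mono {M₁ : ℕ} {R : ℕ → ℝ} {Ω₀ Ω₀' : Set (Site P 0)} {F F' : ℕ → Set (Site P 0)} (hΩ : Ω₀ ⊆ Ω₀')
    (hF : ∀ j, F' j ⊆ F j) : ∀ j, omegaSeq P M₁ R Ω₀ F j ⊆ omegaSeq P M₁ R Ω₀' F' j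
  | 0 => hΩ
  | j + 1 => ruleDom_mono (omegaSeq_mono hΩ hF j) (hF j)

/-- See `omegaSeq_mono`. [cite: Balaban1985UV3, p.268] -/
theorem omegaSeqPt_mono {M₁ : ℕ} {R : ℕ → ℝ} {Ω₀ Ω₀' : Set (Site P 0)} {F F' : ℕ → Set (Site P 0)} (hΩ : Ω₀ ⊆ Ω₀')
    (hF : ∀ j, F' j ⊆ F j) : ∀ j, omegaSeqPt P M₁ R Ω₀ F j ⊆ omegaSeqPt P M₁ R Ω₀' F' j
  | 0 => hΩ
  | j + 1 => ruleDomPt_mono (omegaSeqPt_mono hΩ hF j) (hF j)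

/-- **§4's sequence lies inside print's, scale by scale**: `omegaSeq j ⊆ omegaSeqPt j` — by induction from the one-step comparison
`ruleDom_subset_ruleDomPt` and the monotonicity `ruleDomPt_mono` of the rule in the previous domain (B10 second reader's located
note L-51). [cite: Balaban1985UV3, (38) p.266; p.268] -/
theorem omegaSeq_subset_omegaSeqPt (M₁ : ℕ) (R : ℕ → ℝ) (Ω₀ : Set (Site P 0)) (F : ℕ → Set (Site P 0)) :
    ∀ j, omegaSeq P M₁ R Ω₀ F j ⊆ omegaSeqPt P M₁ R Ω₀ F j
  | 0 => subset_rfl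
  | j + 1 => (ruleDom_subset_ruleDomPt M₁ R j _ _).trans
      (ruleDomPt_mono (omegaSeq_subset_omegaSeqPt M₁ R Ω₀ F j) subset_rfl)

/-- Hence print's `Z_j = Ω_{j+1}ᶜ` lies inside §4's. [cite: Balaban1985UV3, p.266; p.268] -/
theorem Z_ruleSeqPt_subset (M₁ : ℕ) (R : ℕ → ℝ) (Ω₀ : Set (Site P 0)) (F : ℕ → Set (Site P 0)) (j : ℕ) :
    Z (ruleSeqPt P M₁ R Ω₀ F) j ⊆ Z (ruleSeq P M₁ R Ω₀ F) j :=
  Set.compl_subset_compl.mpr (omegaSeq_subset_omegaSeqPt M₁ R Ω₀ F (j + 1))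

end Monotone

end Literature.MathematicalPhysics.QuantumFieldTheory.Balaban1983to89.B10Eq38TorusDomains

end
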